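import Mathlib.Analysis.SpecialFunctions.Trigonometric.Basic
import Mathlib.Analysis.SpecialFunctions.ExpDeriv
import Mathlib.Analysis.Calculus.Deriv.Prod
import Mathlib.Analysis.Calculus.Deriv.Add
import Mathlib.Order.ConditionallyCompleteLattice.Finset
import Mathlib.Algebra.BigOperators.Group.Finset.Basic
import Mathlib.Algebra.Order.BigOperators.Group.Finset
import Mathlib.Algebra.BigOperators.Field
import Literature.Analysis.ODE.MaxLyapunovInvariance
import Literature.Analysis.ODE.LyapunovBarbashinKrasovskii
import Literature.MathematicalPhysics.PowerSystems.DroopControlledInverters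
import HarnessLib

/-!
# Phase cohesiveness of the non-uniform Kuramoto model (Dörfler–Bullo synchronization condition I)

Topic `Literature/MathematicalPhysics/PowerSystems` (LADDER-GRIDFUSION, seat gridfusion-lit-1; the
«N-independent theorem track»: certificates whose size does not grow with the number of machines).

Source: F. Dörfler, F. Bullo, *Synchronization and transient stability in power networks and
non-uniform Kuramoto oscillators*, SIAM J. Control Optim. 50 (2012) [DorflerBullo2012]. The held text is
the long arXiv version 0910.5673; section / theorem / equation LABELS below are those of that text
(§3.1 eq. (Non-uniform Kuramoto model); §3.2 Thm 3.2 (Main synchronization result) statement 1); §5.2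
Lemma 5.2 (Necessary condition), Thm 5.3 (Synchronization condition I) and its proof, eqs. (D+ with cosine
terms), (D+ inequality); Remark 5.4 (classic Kuramoto), eqs. (Kuramoto bound on coupling gain K) and
(… - 2)).

The NON-UNIFORM KURAMOTO MODEL (the overdamped / first-order limit of the network-reduced classical
swing model WITH transfer conductances, and — with zero phase shifts — the droop-controlled inverter
network of Simpson-Porco–Dörfler–Bullo, `DroopControlledInverters.lean`):
`Dᵢ θ̇ᵢ = ωᵢ − Σⱼ Pᵢⱼ sin(θᵢ − θⱼ + φᵢⱼ)`, `Dᵢ > 0`, `Pᵢⱼ ≥ 0`, phase shifts `φᵢⱼ ∈ [0, π/2[` encoding the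
LOSSES (`φᵢⱼ = arctan(Re Yᵢⱼ / Im Yᵢⱼ)`), expanded form `θ̇ᵢ = ωᵢ/Dᵢ − Σⱼ (aᵢⱼ sin(θᵢ−θⱼ) + bᵢⱼ cos(θᵢ−θⱼ))`
with `aᵢⱼ = Pᵢⱼ cos φᵢⱼ / Dᵢ`, `bᵢⱼ = Pᵢⱼ sin φᵢⱼ / Dᵢ`.

PROVED here (0 named facts):
* `arcPolytope n γ = Δ̄(γ)` on real angle lifts (all angles in an arc of length `γ`: `θᵢ − θⱼ ≤ γ ∀ i j`);
* Lemma 5.2 (necessary condition): `|ωᵢ/Dᵢ − ωⱼ/Dⱼ| > Σₖ (Pᵢₖ/Dᵢ + Pⱼₖ/Dⱼ)` ⇒ `θ̇ᵢ ≠ θ̇ⱼ` everywhere;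
* the face estimate of the proof of Thm 5.3 (eq. (D+ with cosine terms) and the two boundings after it):
  on `Δ̄(γ)`, `γ ∈ [0, π]`, at a pair with `θₘ − θ_ℓ = γ`:
  `θ̇ₘ − θ̇_ℓ ≤ (ωₘ/Dₘ − ω_ℓ/D_ℓ) − n·a_min·sin γ + Σₖ bₘₖ + Σₖ b_ℓₖ` (`a_min ≤ aᵢⱼ`, `i ≠ j`);
* THM 5.3 statement 1) = THM 3.2 statement 1) (PHASE COHESIVENESS), strict form: if
  `max_{i≠j}|ωᵢ/Dᵢ − ωⱼ/Dⱼ| + 2 maxᵢ Σⱼ bᵢⱼ < n·min_{i≠j} aᵢⱼ · sin γ` — i.e. (eq. (D+ inequality) strictly)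
  `cos(φ_max)·Γ_critical < Γ_min·sin γ` — then `Δ̄(γ)` is positively invariant; in the BOUNDS form
  (`arcPolytope_invariant_of_bounds`: any exact upper bounds `Ω`, `B` and lower bound `a_min` — the shape a
  kernel certificate uses: `n`-independent, ONE rational inequality) and in the PRINTED form with
  `Γ_min := n min_{i≠j} Pᵢⱼ cos φᵢⱼ/Dᵢ`, `Γ_critical := (max_{i≠j}|ωᵢ/Dᵢ−ωⱼ/Dⱼ| + 2 maxᵢ Σⱼ Pᵢⱼ sin φᵢⱼ/Dᵢ)/cos φ_max`
  (`arcPolytope_invariant`, and `arcPolytope_invariant_of_key` for the key assumption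
  `Γ_min > Γ_critical` ⇒ invariance of `Δ̄(γ)` for every `γ ∈ [π/2 − φ_max, π/2]`);
* Remark 5.4 (classic Kuramoto `θ̇ᵢ = ωᵢ − (K/n)Σⱼ sin(θᵢ−θⱼ)`): `K cos γ ≥ ω_max − ω_min`, `K > 0`,
  `γ ∈ ]0, π/2]` ⇒ `Δ̄(π/2 − γ)` positively invariant (eq. (Kuramoto bound on coupling gain K - 2), the
  non-strict printed form, via the levels-above lemma);
* the bridge to `DroopNetwork` (SPDB2013 Lemma 1: the droop-controlled all-inverter network IS this model
  with `φ = 0`, `ω = P*`, `P = (EᵢEⱼ|Yᵢⱼ|)`), and its phase-cohesiveness corollary.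

## Scope / three columns
CERTIFIED-usable shape: a closed-form, `n`-independent inequality on exact data ⇒ invariance of the
phase-cohesive set for model M = non-uniform Kuramoto (first-order; lossy couplings allowed; COMPLETE
coupling graph needed for `a_min > 0`). NOT typed here: Thm 5.3 statement 2) (exponential frequency
synchronization — needs the consensus contraction Thm 5.1), the «reaches `Δ̄(γ_min)`» clause, and
statements 3)–4) of Thm 3.2 about the second-order swing model (singular perturbation, `O(ε)` — a MODELLED
approximation, not a certificate). The printed statement 1) includes the endpoint levels `γ_min`, `γ_max`
(where `D⁺V ≤ 0` only); we prove the strict-interior form and recover non-strict levels from strict levels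
just above (`γ_min` yes, `γ_max` no). Angles are REAL LIFTS (the tree's convention); the torus statement
for initial data in an arc follows by choosing the lift.

## References
* [DorflerBullo2012] arXiv:0910.5673 §3.1, §3.2 Thm 3.2, §5.2 Lemma 5.2 / Thm 5.3 + proof / Remark 5.4.
* [SimpsonporcoDorflerBullo2013] arXiv:1206.5033 §3 Lemma 1 (droop-controlled network ≡ Kuramoto).
* [LinFrancisMaggiore2007] §2.3 Lemma 2.2 (the `D⁺ max` formula the printed proof invokes; replaced here
  by `Literature.Analysis.ODE.forall_le_of_hasDerivWithinAt_of_eq_imp_deriv_neg`).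
-/

noncomputable section

open Set Filter Finset
open _root_.Topology

namespace Literature.MathematicalPhysics.PowerSystems

/-- The closed PHASE-COHESIVE set `Δ̄(γ)` on real angle lifts: all angles lie in an arc of length `γ`,
i.e. `θᵢ − θⱼ ≤ γ` for all `i, j` (equivalently `maxᵢⱼ |θᵢ − θⱼ| ≤ γ`, `mem_arcPolytope_iff_abs`).
[cite: DorflerBullo2012, arXiv:0910.5673 §2 (notation `Δ̄(γ)`: «arc of length γ») and §5.2 proof of Thm 5.3
(`V(ψ) = max{ψᵢ − ψⱼ}`, «`θ(t) ∈ Δ̄(γ)` if and only if `V(θ(t)) ≤ γ`»)] -/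
def arcPolytope (n : ℕ) (γ : ℝ) : Set (Fin n → ℝ) := {θ | ∀ i j, θ i - θ j ≤ γ}

/-- Membership in `Δ̄(γ)` unfolded. [cite: DorflerBullo2012, arXiv:0910.5673 §5.2 proof of Thm 5.3
(«`θ(t) ∈ Δ̄(γ)` if and only if `V(θ(t)) ≤ γ`»)] -/
theorem mem_arcPolytope_iff {n : ℕ} {γ : ℝ} {θ : Fin n → ℝ} :
    θ ∈ arcPolytope n γ ↔ ∀ i j, θ i - θ j ≤ γ := Iff.rfl

/-- `Δ̄(γ)` in the absolute-value form `|θᵢ − θⱼ| ≤ γ`.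
[cite: DorflerBullo2012, arXiv:0910.5673 §5.2 proof of Thm 5.3 (`V(ψ) = max |ψᵢ − ψⱼ| = max (ψᵢ − ψⱼ)`)] -/
theorem mem_arcPolytope_iff_abs {n : ℕ} {γ : ℝ} {θ : Fin n → ℝ} :
    θ ∈ arcPolytope n γ ↔ ∀ i j, |θ i - θ j| ≤ γ := by
  constructor
  · intro h i j
    rw [abs_sub_le_iff]
    exact ⟨h i j, h j i⟩
  · intro h i j
    exact (le_abs_self _).trans (h i j)

/-- On the face `θₘ − θ_ℓ = γ` of `Δ̄(γ)` every angle lies between `θ_ℓ` and `θₘ`: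
`0 ≤ θₘ − θₖ ≤ γ` and `0 ≤ θₖ − θ_ℓ ≤ γ` («measuring distances counterclockwise … we have
`θₘ − θ_ℓ = γ`, `0 ≤ θₘ − θₖ ≤ γ`, and `0 ≤ θₖ − θ_ℓ ≤ γ`»).
[cite: DorflerBullo2012, arXiv:0910.5673 §5.2 proof of Thm 5.3, text after eq. (D+ with cosine terms)] -/
theorem arcPolytope_face_bounds {n : ℕ} {γ : ℝ} {θ : Fin n → ℝ} (hθ : θ ∈ arcPolytope n γ)
    {m l : Fin n} (hml : θ m - θ l = γ) (k : Fin n) :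
    0 ≤ θ m - θ k ∧ θ m - θ k ≤ γ ∧ 0 ≤ θ k - θ l ∧ θ k - θ l ≤ γ := by
  have h1 := hθ m k
  have h2 := hθ k l
  refine ⟨by linarith, h1, by linarith, h2⟩

/-- Elementary sine bound used on the face: for `x, y ∈ [0, π]`, `sin (x + y) ≤ sin x + sin y`
(`sin(x+y) = sin x cos y + cos x sin y` with `cos ≤ 1`, `sin ≥ 0`). The printed proof reaches the same
bound `sin x + sin y ≥ sin γ` (`x + y = γ ≤ π`) through the sum-to-product identity; this is the shorter
road. [cite: DorflerBullo2012, arXiv:0910.5673 §5.2 proof of Thm 5.3, display after eq. (D+ with cosine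
terms) («`≥ … sin(γ)`»)] -/
theorem sin_add_le_sin_add_sin {x y : ℝ} (hx0 : 0 ≤ x) (hxπ : x ≤ Real.pi) (hy0 : 0 ≤ y)
    (hyπ : y ≤ Real.pi) : Real.sin (x + y) ≤ Real.sin x + Real.sin y := by
  rw [Real.sin_add]
  have hsx := Real.sin_nonneg_of_nonneg_of_le_pi hx0 hxπ
  have hsy := Real.sin_nonneg_of_nonneg_of_le_pi hy0 hyπ
  have h1 : Real.sin x * Real.cos y ≤ Real.sin x := mul_le_of_le_one_right hsx (Real.cos_le_one y)
  have h2 : Real.cos x * Real.sin y ≤ Real.sin y := mul_le_of_le_one_left hsy (Real.cos_le_one x)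
  linarith

/-- Data of the NON-UNIFORM KURAMOTO MODEL `Dᵢ θ̇ᵢ = ωᵢ − Σⱼ Pᵢⱼ sin(θᵢ − θⱼ + φᵢⱼ)`: time constants
`Dᵢ` (`> 0`), natural frequencies `ωᵢ` (for the network-reduced power system: `ωᵢ = P_m,i − Eᵢ² Re Yᵢᵢ`),
coupling weights `Pᵢⱼ = EᵢEⱼ|Yᵢⱼ|` (`Pᵢᵢ = 0` by the printed convention) and phase shifts
`φᵢⱼ = arctan(Re Yᵢⱼ / Im Yᵢⱼ) ∈ [0, π/2[` (`φᵢᵢ = 0`). No sign or diagonal convention is built in;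
the theorems state what they use. MODELLED: first-order (overdamped) limit of the classical model with
transfer conductances; not the second-order swing model.
[cite: DorflerBullo2012, arXiv:0910.5673 §3.1 eq. (Non-uniform Kuramoto model); §2.2 eq. (Classical model)
for `ωᵢ`, `Pᵢⱼ`, `φᵢⱼ`] -/
structure NonuniformKuramoto (n : ℕ) where
  /-- time constants `Dᵢ` -/
  D : Fin n → ℝ
  /-- natural frequencies `ωᵢ` -/
  ω : Fin n → ℝ
  /-- coupling weights `Pᵢⱼ` -/
  P : Fin n → Fin n → ℝ
  /-- phase shifts `φᵢⱼ` (losses) -/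
  φ : Fin n → Fin n → ℝ

namespace NonuniformKuramoto

variable {n : ℕ} (K : NonuniformKuramoto n)

/-- The right-hand side `θ̇ᵢ = (ωᵢ − Σⱼ Pᵢⱼ sin(θᵢ − θⱼ + φᵢⱼ)) / Dᵢ` of the non-uniform Kuramoto model.
[cite: DorflerBullo2012, arXiv:0910.5673 §3.1 eq. (Non-uniform Kuramoto model)] -/
def field (θ : Fin n → ℝ) (i : Fin n) : ℝ :=
  (K.ω i - ∑ j, K.P i j * Real.sin (θ i - θ j + K.φ i j)) / K.D i

/-- Lossless coupling coefficients `aᵢₖ := Pᵢₖ cos(φᵢₖ)/Dᵢ`.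
[cite: DorflerBullo2012, arXiv:0910.5673 §5.2 proof of Thm 5.3, abbreviations after eq. (D+ with cosine terms)] -/
def a (i k : Fin n) : ℝ := K.P i k * Real.cos (K.φ i k) / K.D i

/-- Lossy coupling coefficients `bᵢₖ := Pᵢₖ sin(φᵢₖ)/Dᵢ`.
[cite: DorflerBullo2012, arXiv:0910.5673 §5.2 proof of Thm 5.3, abbreviations after eq. (D+ with cosine terms)] -/
def b (i k : Fin n) : ℝ := K.P i k * Real.sin (K.φ i k) / K.D i

/-- Expanded form of the model: `θ̇ᵢ = ωᵢ/Dᵢ − Σⱼ (aᵢⱼ sin(θᵢ − θⱼ) + bᵢⱼ cos(θᵢ − θⱼ))`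
(`sin(x + φ) = sin x cos φ + cos x sin φ`).
[cite: DorflerBullo2012, arXiv:0910.5673 §5 eq. (non-uniform Kuramoto model - expanded)] -/
theorem field_eq_expanded (θ : Fin n → ℝ) (i : Fin n) :
    K.field θ i = K.ω i / K.D i - ∑ j, (K.a i j * Real.sin (θ i - θ j) + K.b i j * Real.cos (θ i - θ j)) := by
  unfold field a b
  rw [sub_div, Finset.sum_div]
  congr 1
  refine Finset.sum_congr rfl fun j _ => ?_
  rw [Real.sin_add]
  ring

/-- The phase-difference dynamics (eq. (Non-uniform Kuramoto model - phase differences - in components))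
in expanded form: `θ̇ₘ − θ̇_ℓ = ωₘ/Dₘ − ω_ℓ/D_ℓ − Σₖ (aₘₖ sin(θₘ−θₖ) + a_ℓₖ sin(θₖ−θ_ℓ))
− Σₖ (bₘₖ cos(θₘ−θₖ) − b_ℓₖ cos(θ_ℓ−θₖ))` — eq. (D+ with cosine terms) read as an identity for the pair
`(m, ℓ)`. [cite: DorflerBullo2012, arXiv:0910.5673 §5.2 eq. (D+ with cosine terms)] -/
theorem field_sub_field_eq (θ : Fin n → ℝ) (m l : Fin n) :
    K.field θ m - K.field θ l = (K.ω m / K.D m - K.ω l / K.D l)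
      - ∑ k, (K.a m k * Real.sin (θ m - θ k) + K.a l k * Real.sin (θ k - θ l))
      - ∑ k, (K.b m k * Real.cos (θ m - θ k) - K.b l k * Real.cos (θ l - θ k)) := by
  rw [K.field_eq_expanded θ m, K.field_eq_expanded θ l]
  have h : ∀ k, Real.sin (θ k - θ l) = -Real.sin (θ l - θ k) := fun k => by
    rw [← Real.sin_neg, neg_sub]
  simp_rw [h]
  have e1 : ∑ k, (K.a m k * Real.sin (θ m - θ k) + K.a l k * -Real.sin (θ l - θ k))
      = ∑ k, K.a m k * Real.sin (θ m - θ k) - ∑ k, K.a l k * Real.sin (θ l - θ k) := by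
    rw [← Finset.sum_sub_distrib]
    exact Finset.sum_congr rfl fun k _ => by ring
  have e2 : ∑ k, (K.b m k * Real.cos (θ m - θ k) - K.b l k * Real.cos (θ l - θ k))
      = ∑ k, K.b m k * Real.cos (θ m - θ k) - ∑ k, K.b l k * Real.cos (θ l - θ k) :=
    Finset.sum_sub_distrib _ _
  have e3 : ∑ j, (K.a m j * Real.sin (θ m - θ j) + K.b m j * Real.cos (θ m - θ j))
      = ∑ j, K.a m j * Real.sin (θ m - θ j) + ∑ j, K.b m j * Real.cos (θ m - θ j) :=
    Finset.sum_add_distrib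
  have e4 : ∑ j, (K.a l j * Real.sin (θ l - θ j) + K.b l j * Real.cos (θ l - θ j))
      = ∑ j, K.a l j * Real.sin (θ l - θ j) + ∑ j, K.b l j * Real.cos (θ l - θ j) :=
    Finset.sum_add_distrib
  rw [e1, e2, e3, e4]
  ring

/-- **Lemma 5.2 (Necessary condition on synchronization)**, pointwise form: if
`|ωᵢ/Dᵢ − ωⱼ/Dⱼ| > Σₖ (Pᵢₖ/Dᵢ + Pⱼₖ/Dⱼ)` («the coupling between oscillators `i` and `j` needs to dominate
their non-uniformity»), then `θ̇ᵢ ≠ θ̇ⱼ` at EVERY phase vector — so no solution has `θ̇ᵢ(t) = θ̇ⱼ(t)`,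
`t ≥ 0`. Hypotheses used: `Dᵢ, Dⱼ > 0`, `Pᵢₖ, Pⱼₖ ≥ 0`.
[cite: DorflerBullo2012, arXiv:0910.5673 §5.2 Lemma 5.2, eq. (necessary sync condition)] -/
theorem field_ne_field_of_necessary (hD : ∀ i, 0 < K.D i) (hP : ∀ i j, 0 ≤ K.P i j) {i j : Fin n}
    (h : ∑ k, (K.P i k / K.D i + K.P j k / K.D j) < |K.ω i / K.D i - K.ω j / K.D j|)
    (θ : Fin n → ℝ) : K.field θ i ≠ K.field θ j := by
  intro heq
  have hdi := hD i
  have hdj := hD j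
  -- the coupling difference is bounded by the sum of the weights
  set Si := ∑ k, K.P i k * Real.sin (θ i - θ k + K.φ i k) with hSi
  set Sj := ∑ k, K.P j k * Real.sin (θ j - θ k + K.φ j k) with hSj
  have hfi : K.field θ i = K.ω i / K.D i - Si / K.D i := by unfold field; rw [sub_div]
  have hfj : K.field θ j = K.ω j / K.D j - Sj / K.D j := by unfold field; rw [sub_div]
  have hbound : |Si / K.D i - Sj / K.D j| ≤ ∑ k, (K.P i k / K.D i + K.P j k / K.D j) := by
    have hSi' : |Si / K.D i| ≤ ∑ k, K.P i k / K.D i := by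
      rw [abs_div, abs_of_pos hdi, hSi, ← Finset.sum_div]
      refine div_le_div_of_nonneg_right ((Finset.abs_sum_le_sum_abs _ _).trans
        (Finset.sum_le_sum fun k _ => ?_)) hdi.le
      rw [abs_mul, abs_of_nonneg (hP i k)]
      exact mul_le_of_le_one_right (hP i k) (Real.abs_sin_le_one _)
    have hSj' : |Sj / K.D j| ≤ ∑ k, K.P j k / K.D j := by
      rw [abs_div, abs_of_pos hdj, hSj, ← Finset.sum_div]
      refine div_le_div_of_nonneg_right ((Finset.abs_sum_le_sum_abs _ _).trans
        (Finset.sum_le_sum fun k _ => ?_)) hdj.le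
      rw [abs_mul, abs_of_nonneg (hP j k)]
      exact mul_le_of_le_one_right (hP j k) (Real.abs_sin_le_one _)
    calc |Si / K.D i - Sj / K.D j| ≤ |Si / K.D i| + |Sj / K.D j| := abs_sub _ _
      _ ≤ ∑ k, K.P i k / K.D i + ∑ k, K.P j k / K.D j := add_le_add hSi' hSj'
      _ = ∑ k, (K.P i k / K.D i + K.P j k / K.D j) := by rw [Finset.sum_add_distrib]
  have hω : K.ω i / K.D i - K.ω j / K.D j = Si / K.D i - Sj / K.D j := by
    rw [hfi, hfj] at heq; linarith
  rw [hω] at h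
  exact absurd (hbound.trans_lt h) (lt_irrefl _)

/-- Lemma 5.2 along a solution: under eq. (necessary sync condition) the velocities of oscillators `i`
and `j` differ at every time of any solution (tree convention: derivative within `[0, T]`), so there is
no frequency-synchronized solution. [cite: DorflerBullo2012, arXiv:0910.5673 §5.2 Lemma 5.2] -/
theorem deriv_ne_deriv_of_necessary (hD : ∀ i, 0 < K.D i) (hP : ∀ i j, 0 ≤ K.P i j) {i j : Fin n}
    (h : ∑ k, (K.P i k / K.D i + K.P j k / K.D j) < |K.ω i / K.D i - K.ω j / K.D j|)
    {θ : ℝ → Fin n → ℝ} {T : ℝ} {wi wj : ℝ} {t : ℝ} (ht : t ∈ Icc 0 T)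
    (hθ : HasDerivWithinAt θ (K.field (θ t)) (Icc 0 T) t) (hT : 0 < T)
    (hwi : HasDerivWithinAt (fun s => θ s i) wi (Icc 0 T) t)
    (hwj : HasDerivWithinAt (fun s => θ s j) wj (Icc 0 T) t) : wi ≠ wj := by
  have hu : UniqueDiffWithinAt ℝ (Icc 0 T) t := uniqueDiffOn_Icc hT t ht
  have hi : wi = K.field (θ t) i := hu.eq_deriv _ hwi ((hasDerivWithinAt_pi.1 hθ) i)
  have hj : wj = K.field (θ t) j := hu.eq_deriv _ hwj ((hasDerivWithinAt_pi.1 hθ) j)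
  rw [hi, hj]
  exact K.field_ne_field_of_necessary hD hP h (θ t)

/-- **The face estimate of the contraction argument** (eq. (D+ with cosine terms) and the two boundings
after it, summed): on `Δ̄(γ)`, `0 ≤ γ ≤ π`, at a pair `m ≠ ℓ` with `θₘ − θ_ℓ = γ`, if `0 ≤ a_min ≤ aᵢⱼ`
for all `i ≠ j` and all `bᵢⱼ ≥ 0`, then
`θ̇ₘ − θ̇_ℓ ≤ (ωₘ/Dₘ − ω_ℓ/D_ℓ) − n·a_min·sin γ + Σₖ bₘₖ + Σₖ b_ℓₖ`. Printed: each sinusoidal term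
`aₘₖ sin(θₘ−θₖ) + a_ℓₖ sin(θₖ−θ_ℓ) ≥ min{aᵢₖ} sin γ` and the cosine terms `≥ −bₘₖ − b_ℓₖ`; summing gives
`D⁺V ≤ max|ωᵢ/Dᵢ−ωⱼ/Dⱼ| − n min aᵢⱼ sin γ + 2 max Σⱼ bᵢⱼ`. (No diagonal convention needed: the `k = m`,
`k = ℓ` terms have `sin 0 = 0`.) [cite: DorflerBullo2012, arXiv:0910.5673 §5.2 proof of Thm 5.3, eq.
(D+ with cosine terms) and the displays after it] -/
theorem field_sub_field_le_of_face {γ amin : ℝ} (hγπ : γ ≤ Real.pi)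
    (hamin0 : 0 ≤ amin) (hamin : ∀ i j, i ≠ j → amin ≤ K.a i j) (hb : ∀ i j, 0 ≤ K.b i j)
    {θ : Fin n → ℝ} (hθ : θ ∈ arcPolytope n γ) {m l : Fin n} (hml : θ m - θ l = γ) :
    K.field θ m - K.field θ l
      ≤ (K.ω m / K.D m - K.ω l / K.D l) - n * amin * Real.sin γ + ∑ k, K.b m k + ∑ k, K.b l k := by
  rw [K.field_sub_field_eq θ m l]
  -- termwise lower bounds
  have hsin : ∀ k, amin * Real.sin γ ≤ K.a m k * Real.sin (θ m - θ k) + K.a l k * Real.sin (θ k - θ l) := by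
    intro k
    obtain ⟨hx0, hxγ, hy0, hyγ⟩ := arcPolytope_face_bounds hθ hml k
    have hxπ : θ m - θ k ≤ Real.pi := hxγ.trans hγπ
    have hyπ : θ k - θ l ≤ Real.pi := hyγ.trans hγπ
    have hsx := Real.sin_nonneg_of_nonneg_of_le_pi hx0 hxπ
    have hsy := Real.sin_nonneg_of_nonneg_of_le_pi hy0 hyπ
    -- `aₘₖ sin x ≥ a_min sin x` (for `k = m`, `x = 0`)
    have h1 : amin * Real.sin (θ m - θ k) ≤ K.a m k * Real.sin (θ m - θ k) := by
      rcases eq_or_ne m k with hmk | hmk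
      · subst hmk; simp
      · exact mul_le_mul_of_nonneg_right (hamin m k hmk) hsx
    have h2 : amin * Real.sin (θ k - θ l) ≤ K.a l k * Real.sin (θ k - θ l) := by
      rcases eq_or_ne l k with hlk | hlk
      · subst hlk; simp
      · exact mul_le_mul_of_nonneg_right (hamin l k hlk) hsy
    have h3 : Real.sin γ ≤ Real.sin (θ m - θ k) + Real.sin (θ k - θ l) := by
      have := sin_add_le_sin_add_sin hx0 hxπ hy0 hyπ
      rwa [show θ m - θ k + (θ k - θ l) = γ by linarith] at this
    nlinarith
  have hcos : ∀ k, -(K.b m k + K.b l k) ≤ K.b m k * Real.cos (θ m - θ k) - K.b l k * Real.cos (θ l - θ k) := by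
    intro k
    have h1 : -K.b m k ≤ K.b m k * Real.cos (θ m - θ k) := by
      have := mul_le_mul_of_nonneg_left (Real.neg_one_le_cos (θ m - θ k)) (hb m k)
      linarith
    have h2 : K.b l k * Real.cos (θ l - θ k) ≤ K.b l k :=
      mul_le_of_le_one_right (hb l k) (Real.cos_le_one _)
    linarith
  have hS1 : (n : ℝ) * amin * Real.sin γ
      ≤ ∑ k, (K.a m k * Real.sin (θ m - θ k) + K.a l k * Real.sin (θ k - θ l)) := by
    have := Finset.sum_le_sum fun k (_ : k ∈ (Finset.univ : Finset (Fin n))) => hsin k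
    rw [Finset.sum_const, Finset.card_univ, Fintype.card_fin, nsmul_eq_mul] at this
    linarith
  have hS2 : -(∑ k, K.b m k + ∑ k, K.b l k)
      ≤ ∑ k, (K.b m k * Real.cos (θ m - θ k) - K.b l k * Real.cos (θ l - θ k)) := by
    have := Finset.sum_le_sum fun k (_ : k ∈ (Finset.univ : Finset (Fin n))) => hcos k
    rw [Finset.sum_neg_distrib, Finset.sum_add_distrib] at this
    exact this
  linarith

/-- The strict face condition: with bounds `ωᵢ/Dᵢ − ωⱼ/Dⱼ ≤ Ω`, `Σⱼ bᵢⱼ ≤ B`, `a_min ≤ aᵢⱼ` (`i ≠ j`),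
`bᵢⱼ ≥ 0` and the strict key inequality `Ω + 2B < n·a_min·sin γ` (`0 ≤ γ ≤ π`), every active pair of
`Δ̄(γ)` has `θ̇ₘ − θ̇_ℓ < 0` («`V(θ(t))` is strictly decreasing»). (`a_min ≥ 0` and `m ≠ ℓ` are forced by
the inequality once an index exists.) [cite: DorflerBullo2012, arXiv:0910.5673 §5.2 proof of Thm 5.3, eq.
(D+ inequality) with strict sign] -/
theorem field_sub_field_neg_of_face {γ amin Ω B : ℝ} (hγ0 : 0 ≤ γ) (hγπ : γ ≤ Real.pi)
    (hamin : ∀ i j, i ≠ j → amin ≤ K.a i j) (hb : ∀ i j, 0 ≤ K.b i j)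
    (hΩ : ∀ i j, K.ω i / K.D i - K.ω j / K.D j ≤ Ω) (hB : ∀ i, ∑ j, K.b i j ≤ B)
    (hkey : Ω + 2 * B < n * amin * Real.sin γ)
    {θ : Fin n → ℝ} (hθ : θ ∈ arcPolytope n γ) {m l : Fin n} (hml : θ m - θ l = γ) :
    K.field θ m - K.field θ l < 0 := by
  have hΩ0 : 0 ≤ Ω := by have := hΩ m m; simpa using this
  have hB0 : 0 ≤ B := (Finset.sum_nonneg fun j _ => hb m j).trans (hB m)
  have hsin0 : 0 ≤ Real.sin γ := Real.sin_nonneg_of_nonneg_of_le_pi hγ0 hγπ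
  have hamin0 : 0 ≤ amin := by
    by_contra hneg
    push Not at hneg
    have : (n : ℝ) * amin * Real.sin γ ≤ 0 :=
      mul_nonpos_of_nonpos_of_nonneg (mul_nonpos_of_nonneg_of_nonpos (Nat.cast_nonneg n) hneg.le) hsin0
    linarith
  have hface := K.field_sub_field_le_of_face hγπ hamin0 hamin hb hθ hml
  have h1 := hΩ m l
  have h2 := hB m
  have h3 := hB l
  linarith

/-- **Theorem 5.3 statement 1) / Theorem 3.2 statement 1) (PHASE COHESIVENESS), bounds form.** For the
non-uniform Kuramoto model with `bᵢⱼ ≥ 0`, any bounds `Ω ≥ ωᵢ/Dᵢ − ωⱼ/Dⱼ`, `B ≥ Σⱼ bᵢⱼ`, `a_min ≤ aᵢⱼ`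
(`i ≠ j`) and a level `γ ∈ [0, π]` with the STRICT inequality `Ω + 2B < n·a_min·sin γ` (eq. (D+ inequality)
with `Γ_min ≥ n a_min`, `cos φ_max Γ_critical ≤ Ω + 2B`), the phase-cohesive set `Δ̄(γ)` is positively
invariant: every solution on `[0, T]` (tree convention) starting in `Δ̄(γ)` stays in `Δ̄(γ)`. This is the
`n`-INDEPENDENT certificate shape: three exact bounds and one inequality. Proof = the printed contraction
argument (`V = max(θᵢ − θⱼ)` does not increase on its level set) via
`Literature.Analysis.ODE.forall_le_of_hasDerivWithinAt_of_eq_imp_deriv_neg`.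
[cite: DorflerBullo2012, arXiv:0910.5673 §5.2 Thm 5.3 (Synchronization condition I) statement 1) and its
proof; §3.2 Thm 3.2 statement 1)] -/
theorem arcPolytope_invariant_of_bounds {γ amin Ω B T : ℝ} (hγ0 : 0 ≤ γ) (hγπ : γ ≤ Real.pi)
    (hamin : ∀ i j, i ≠ j → amin ≤ K.a i j) (hb : ∀ i j, 0 ≤ K.b i j)
    (hΩ : ∀ i j, K.ω i / K.D i - K.ω j / K.D j ≤ Ω) (hB : ∀ i, ∑ j, K.b i j ≤ B)
    (hkey : Ω + 2 * B < n * amin * Real.sin γ)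
    {θ : ℝ → Fin n → ℝ} (hθ : ∀ t ∈ Icc 0 T, HasDerivWithinAt θ (K.field (θ t)) (Icc 0 T) t)
    (h0 : θ 0 ∈ arcPolytope n γ) : ∀ t ∈ Icc 0 T, θ t ∈ arcPolytope n γ := by
  have key := Literature.Analysis.ODE.forall_le_of_hasDerivWithinAt_of_eq_imp_deriv_neg
    (ι := Fin n × Fin n) (h := fun p t => θ t p.1 - θ t p.2)
    (h' := fun p t => K.field (θ t) p.1 - K.field (θ t) p.2) (c := fun _ => γ) (T := T)
    (fun p t ht => ((hasDerivWithinAt_pi.1 (hθ t ht)) p.1).sub ((hasDerivWithinAt_pi.1 (hθ t ht)) p.2))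
    (fun t _ hall p hp => K.field_sub_field_neg_of_face hγ0 hγπ hamin hb hΩ hB hkey
      (θ := θ t) (fun i j => hall (i, j)) hp)
    (fun p => h0 p.1 p.2)
  intro t ht i j
  exact key t ht (i, j)

/-- Scope check (two oscillators, `D = 1`, `ω = (0, 1/2)`, `P₁₂ = P₂₁ = 1`, `φ = 0`): with `Ω = 1/2`,
`B = 0`, `a_min = 1` the key inequality at `γ = π/2` reads `1/2 < 2`, so `Δ̄(π/2)` is positively invariant —
the hypotheses of `arcPolytope_invariant_of_bounds` are satisfiable by exact data. -/
example {T : ℝ} {θ : ℝ → Fin 2 → ℝ}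
    (hθ : ∀ t ∈ Icc 0 T, HasDerivWithinAt θ
      ((⟨fun _ => 1, ![0, 1 / 2], fun i j => if i = j then 0 else 1, fun _ _ => 0⟩ :
        NonuniformKuramoto 2).field (θ t)) (Icc 0 T) t)
    (h0 : θ 0 ∈ arcPolytope 2 (Real.pi / 2)) : ∀ t ∈ Icc 0 T, θ t ∈ arcPolytope 2 (Real.pi / 2) := by
  refine NonuniformKuramoto.arcPolytope_invariant_of_bounds _ (amin := 1) (Ω := 1 / 2) (B := 0)
    (by positivity) (by linarith [Real.pi_pos]) (fun i j hij => ?_) (fun i j => ?_) (fun i j => ?_)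
    (fun i => ?_) ?_ hθ h0
  · simp [NonuniformKuramoto.a, hij]
  · simp [NonuniformKuramoto.b]
  · fin_cases i <;> fin_cases j <;> simp
  · simp [NonuniformKuramoto.b]
  · rw [Real.sin_pi_div_two]; norm_num

/-- Invariance of `Δ̄(γ)` when the strict key inequality is only known at the levels JUST ABOVE `γ`
(`Ω + 2B < n a_min sin γ'` for all `γ' ∈ ]γ, γ + δ[`, these levels in `[0, π]`): recovers the printed
non-strict endpoint `γ_min` of Thm 5.3 1) and the «`K ≥ K(γ)`» form of Remark 5.4.
[cite: DorflerBullo2012, arXiv:0910.5673 §5.2 proof of Thm 5.3 («non-increasing … for all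
`γ ∈ [γ_min, γ_max]`»); Remark 5.4 eq. (Kuramoto bound on coupling gain K - 2)] -/
theorem arcPolytope_invariant_of_bounds_above {γ δ amin Ω B T : ℝ} (hγ0 : 0 ≤ γ) (hδ : 0 < δ)
    (hγδπ : γ + δ ≤ Real.pi)
    (hamin : ∀ i j, i ≠ j → amin ≤ K.a i j) (hb : ∀ i j, 0 ≤ K.b i j)
    (hΩ : ∀ i j, K.ω i / K.D i - K.ω j / K.D j ≤ Ω) (hB : ∀ i, ∑ j, K.b i j ≤ B)
    (hkey : ∀ γ', γ < γ' → γ' < γ + δ → Ω + 2 * B < n * amin * Real.sin γ')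
    {θ : ℝ → Fin n → ℝ} (hθ : ∀ t ∈ Icc 0 T, HasDerivWithinAt θ (K.field (θ t)) (Icc 0 T) t)
    (h0 : θ 0 ∈ arcPolytope n γ) : ∀ t ∈ Icc 0 T, θ t ∈ arcPolytope n γ := by
  have key := Literature.Analysis.ODE.forall_le_of_hasDerivWithinAt_of_levels_above
    (ι := Fin n × Fin n) (h := fun p t => θ t p.1 - θ t p.2)
    (h' := fun p t => K.field (θ t) p.1 - K.field (θ t) p.2) (c := fun _ => γ) (T := T) hδ
    (fun p t ht => ((hasDerivWithinAt_pi.1 (hθ t ht)) p.1).sub ((hasDerivWithinAt_pi.1 (hθ t ht)) p.2))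
    (fun ε hε0 hεδ t _ hall p hp =>
      K.field_sub_field_neg_of_face (γ := γ + ε) (by linarith) (by linarith) hamin hb hΩ hB
        (hkey (γ + ε) (by linarith) (by linarith)) (θ := θ t) (fun i j => hall (i, j)) hp)
    (fun p => h0 p.1 p.2)
  intro t ht i j
  exact key t ht (i, j)

/-! ### The printed constants `Γ_min`, `Γ_critical`, `φ_max` -/

/-- Index type of ordered pairs of DISTINCT oscillators (the `i ≠ j` in `min_{i≠j}`, `max_{i≠j}`).
[cite: DorflerBullo2012, arXiv:0910.5673 §5.2 Thm 5.3, eq. (key-assumption - Kuramoto)] -/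
abbrev DistinctPair (n : ℕ) : Type := {p : Fin n × Fin n // p.1 ≠ p.2}

/-- `Γ_min := n · min_{i≠j} {Pᵢⱼ cos(φᵢⱼ)/Dᵢ}` («the minimal lossless coupling of any oscillator to the
network»; for `n ≤ 1` the empty minimum is `0` by the `ℝ` convention).
[cite: DorflerBullo2012, arXiv:0910.5673 §5.2 Thm 5.3 eq. (key-assumption - Kuramoto); §3.2 Thm 3.2 eq.
(key-assumption)] -/
def GammaMin : ℝ := n * ⨅ p : DistinctPair n, K.a p.1.1 p.1.2

/-- `max_{i≠j} |ωᵢ/Dᵢ − ωⱼ/Dⱼ|` (maximal non-uniformity of the scaled natural frequencies).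
[cite: DorflerBullo2012, arXiv:0910.5673 §5.2 Thm 5.3 eq. (key-assumption - Kuramoto)] -/
def freqSpread : ℝ := ⨆ p : DistinctPair n, |K.ω p.1.1 / K.D p.1.1 - K.ω p.1.2 / K.D p.1.2|

/-- `maxᵢ Σⱼ Pᵢⱼ sin(φᵢⱼ)/Dᵢ` (maximal lossy coupling).
[cite: DorflerBullo2012, arXiv:0910.5673 §5.2 Thm 5.3 eq. (key-assumption - Kuramoto)] -/
def lossyMax : ℝ := ⨆ i : Fin n, ∑ j, K.b i j

/-- `φ_max := max_{i≠j} φᵢⱼ`. [cite: DorflerBullo2012, arXiv:0910.5673 §2.2 / §5.2 (notation `φ_max`)] -/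
def phiMax : ℝ := ⨆ p : DistinctPair n, K.φ p.1.1 p.1.2

/-- `Γ_critical := (1/cos φ_max)(max_{i≠j}|ωᵢ/Dᵢ − ωⱼ/Dⱼ| + 2 maxᵢ Σⱼ Pᵢⱼ sin(φᵢⱼ)/Dᵢ)`.
[cite: DorflerBullo2012, arXiv:0910.5673 §5.2 Thm 5.3 eq. (key-assumption - Kuramoto); §3.2 eq.
(key-assumption)] -/
def GammaCrit : ℝ := (K.freqSpread + 2 * K.lossyMax) / Real.cos K.phiMax

/-- `Γ_min ≤ n·aᵢⱼ` for every pair `i ≠ j` (the minimum is a lower bound). [cite: DorflerBullo2012, arXiv:0910.5673 §5.2 Thm 5.3 eq. (key-assumption - Kuramoto)] -/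
theorem GammaMin_le {i j : Fin n} (hij : i ≠ j) : K.GammaMin ≤ n * K.a i j := by
  unfold GammaMin
  refine mul_le_mul_of_nonneg_left ?_ (Nat.cast_nonneg n)
  exact ciInf_le (Set.finite_range _).bddBelow (⟨(i, j), hij⟩ : DistinctPair n)

/-- `|ωᵢ/Dᵢ − ωⱼ/Dⱼ| ≤ max_{i≠j}|ωᵢ/Dᵢ − ωⱼ/Dⱼ|`. [cite: DorflerBullo2012, arXiv:0910.5673 §5.2 Thm 5.3 eq. (key-assumption - Kuramoto)] -/
theorem le_freqSpread {i j : Fin n} (hij : i ≠ j) :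
    |K.ω i / K.D i - K.ω j / K.D j| ≤ K.freqSpread := by
  unfold freqSpread
  exact le_ciSup (f := fun p : DistinctPair n => |K.ω p.1.1 / K.D p.1.1 - K.ω p.1.2 / K.D p.1.2|)
    (Set.finite_range _).bddAbove ⟨(i, j), hij⟩

/-- `Σⱼ bᵢⱼ ≤ maxᵢ Σⱼ bᵢⱼ`. [cite: DorflerBullo2012, arXiv:0910.5673 §5.2 Thm 5.3 eq. (key-assumption - Kuramoto)] -/
theorem le_lossyMax (i : Fin n) : ∑ j, K.b i j ≤ K.lossyMax := by
  unfold lossyMax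
  exact le_ciSup (f := fun i : Fin n => ∑ j, K.b i j) (Set.finite_range _).bddAbove i

/-- `φᵢⱼ ≤ φ_max` for `i ≠ j`. [cite: DorflerBullo2012, arXiv:0910.5673 §5.2 Thm 5.3 (notation `φ_max`)] -/
theorem le_phiMax {i j : Fin n} (hij : i ≠ j) : K.φ i j ≤ K.phiMax := by
  unfold phiMax
  exact le_ciSup (f := fun p : DistinctPair n => K.φ p.1.1 p.1.2) (Set.finite_range _).bddAbove
    ⟨(i, j), hij⟩

/-- `max_{i≠j}|ωᵢ/Dᵢ − ωⱼ/Dⱼ| ≥ 0` (also for the empty maximum, `= 0` in `ℝ`). [cite: DorflerBullo2012, arXiv:0910.5673 §5.2 Thm 5.3 eq. (key-assumption - Kuramoto)] -/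
theorem freqSpread_nonneg : 0 ≤ K.freqSpread := by
  unfold freqSpread
  exact Real.iSup_nonneg fun p => abs_nonneg _

/-- `maxᵢ Σⱼ bᵢⱼ ≥ 0` when all `bᵢⱼ ≥ 0`. [cite: DorflerBullo2012, arXiv:0910.5673 §5.2 Thm 5.3 eq. (key-assumption - Kuramoto)] -/
theorem lossyMax_nonneg (hb : ∀ i j, 0 ≤ K.b i j) : 0 ≤ K.lossyMax := by
  unfold lossyMax
  exact Real.iSup_nonneg fun i => Finset.sum_nonneg fun j _ => hb i j

/-- With `φᵢⱼ ∈ [0, π/2[` off the diagonal, `φ_max ∈ [0, π/2[` (a maximum over a finite set, or `0`).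
[cite: DorflerBullo2012, arXiv:0910.5673 §3.1 («`φᵢⱼ ∈ [0, π/2[` … `i ≠ j`») and §5.2 Thm 5.3 (`φ_max`)] -/
theorem phiMax_mem (hφ0 : ∀ i j, i ≠ j → 0 ≤ K.φ i j) (hφ : ∀ i j, i ≠ j → K.φ i j < Real.pi / 2) :
    0 ≤ K.phiMax ∧ K.phiMax < Real.pi / 2 := by
  unfold phiMax
  rcases isEmpty_or_nonempty (DistinctPair n) with hE | hE
  · rw [Real.iSup_of_isEmpty]
    exact ⟨le_rfl, by positivity⟩
  · obtain ⟨p, hp⟩ := exists_eq_ciSup_of_finite (f := fun p : DistinctPair n => K.φ p.1.1 p.1.2)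
    rw [← hp]
    exact ⟨hφ0 _ _ p.2, hφ _ _ p.2⟩

/-- `cos φ_max > 0` (so `Γ_critical = (…)/cos φ_max` is a genuine quotient and `γ* = π/2 − φ_max > 0`).
[cite: DorflerBullo2012, arXiv:0910.5673 §5.2 Thm 5.3 eq. (key-assumption - Kuramoto) (the factor `1/cos(φ_max)`)] -/
theorem cos_phiMax_pos (hφ0 : ∀ i j, i ≠ j → 0 ≤ K.φ i j) (hφ : ∀ i j, i ≠ j → K.φ i j < Real.pi / 2) :
    0 < Real.cos K.phiMax := by
  obtain ⟨h0, h1⟩ := K.phiMax_mem hφ0 hφ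
  exact Real.cos_pos_of_mem_Ioo ⟨by linarith [Real.pi_pos], h1⟩

/-- Signs of the coupling coefficients from the printed parameter ranges `Dᵢ > 0`, `Pᵢⱼ ≥ 0`,
`φᵢⱼ ∈ [0, π/2]`: `aᵢⱼ ≥ 0` and `bᵢⱼ ≥ 0`.
[cite: DorflerBullo2012, arXiv:0910.5673 §3.1 (parameter assumptions after eq. (Non-uniform Kuramoto model))] -/
theorem a_nonneg_b_nonneg (hD : ∀ i, 0 < K.D i) (hP : ∀ i j, 0 ≤ K.P i j)
    (hφ0 : ∀ i j, 0 ≤ K.φ i j) (hφ : ∀ i j, K.φ i j ≤ Real.pi / 2) (i j : Fin n) :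
    0 ≤ K.a i j ∧ 0 ≤ K.b i j := by
  refine ⟨div_nonneg (mul_nonneg (hP i j) (Real.cos_nonneg_of_neg_pi_div_two_le_of_le
    (by linarith [hφ0 i j, Real.pi_pos]) (hφ i j))) (hD i).le,
    div_nonneg (mul_nonneg (hP i j) (Real.sin_nonneg_of_nonneg_of_le_pi (hφ0 i j)
    (by linarith [hφ i j, Real.pi_pos]))) (hD i).le⟩

/-- **Theorem 5.3 statement 1), printed constants.** Parameters as printed (`Dᵢ > 0`, `Pᵢⱼ ≥ 0`,
`φᵢⱼ ∈ [0, π/2]`), a level `γ ∈ [0, π]` satisfying eq. (D+ inequality) STRICTLY,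
`cos(φ_max)·Γ_critical < Γ_min·sin γ` — by strict concavity of the left side this is exactly
`γ ∈ ]γ_min, γ_max[` — then `Δ̄(γ)` is positively invariant along every solution on `[0, T]`.
(Needs `φᵢⱼ < π/2` off the diagonal so that `cos φ_max > 0`.)
[cite: DorflerBullo2012, arXiv:0910.5673 §5.2 Thm 5.3 statement 1), eq. (D+ inequality); §3.2 Thm 3.2
statement 1)] -/
theorem arcPolytope_invariant (hD : ∀ i, 0 < K.D i) (hP : ∀ i j, 0 ≤ K.P i j)
    (hφ0 : ∀ i j, 0 ≤ K.φ i j) (hφle : ∀ i j, K.φ i j ≤ Real.pi / 2)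
    (hφlt : ∀ i j, i ≠ j → K.φ i j < Real.pi / 2) {γ T : ℝ} (hγ0 : 0 ≤ γ) (hγπ : γ ≤ Real.pi)
    (hkey : Real.cos K.phiMax * K.GammaCrit < K.GammaMin * Real.sin γ)
    {θ : ℝ → Fin n → ℝ} (hθ : ∀ t ∈ Icc 0 T, HasDerivWithinAt θ (K.field (θ t)) (Icc 0 T) t)
    (h0 : θ 0 ∈ arcPolytope n γ) : ∀ t ∈ Icc 0 T, θ t ∈ arcPolytope n γ := by
  have hcos := K.cos_phiMax_pos (fun i j _ => hφ0 i j) hφlt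
  have hb : ∀ i j, 0 ≤ K.b i j := fun i j => (K.a_nonneg_b_nonneg hD hP hφ0 hφle i j).2
  have hkey' : K.freqSpread + 2 * K.lossyMax
      < n * (⨅ p : DistinctPair n, K.a p.1.1 p.1.2) * Real.sin γ := by
    have h1 : Real.cos K.phiMax * K.GammaCrit = K.freqSpread + 2 * K.lossyMax := by
      unfold GammaCrit
      rw [mul_div_cancel₀ _ hcos.ne']
    rw [← h1]
    simpa [GammaMin] using hkey
  exact K.arcPolytope_invariant_of_bounds hγ0 hγπ
    (fun i j hij => ciInf_le (Set.finite_range _).bddBelow (⟨(i, j), hij⟩ : DistinctPair n)) hb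
    (fun i j => by
      rcases eq_or_ne i j with hij | hij
      · subst hij; simp [K.freqSpread_nonneg]
      · exact (le_abs_self _).trans (K.le_freqSpread hij))
    K.le_lossyMax hkey' hθ h0

/-- **Theorem 5.3 under its key assumption `Γ_min > Γ_critical`** (eq. (key-assumption - Kuramoto),
«the minimal lossless coupling of any oscillator to the network is larger than a critical value»): then
(D+ inequality) holds strictly at `γ* = π/2 − φ_max` and, `sin` being larger there, at every
`γ ∈ [π/2 − φ_max, π/2]`; hence each such `Δ̄(γ)` is positively invariant — in particular
`Δ̄(π/2 − φ_max)`, the set on which Thm 5.1 (frequency synchronization, not typed) operates.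
[cite: DorflerBullo2012, arXiv:0910.5673 §5.2 Thm 5.3 (eq. (key-assumption - Kuramoto)) and proof («there
exists an open set of arc lengths `γ` including `γ* = π/2 − φ_max` … if and only if … is true at `γ*` with
the strict inequality sign»); §3.2 Thm 3.2] -/
theorem arcPolytope_invariant_of_key (hD : ∀ i, 0 < K.D i) (hP : ∀ i j, 0 ≤ K.P i j)
    (hφ0 : ∀ i j, 0 ≤ K.φ i j) (hφle : ∀ i j, K.φ i j ≤ Real.pi / 2)
    (hφlt : ∀ i j, i ≠ j → K.φ i j < Real.pi / 2) (hkey : K.GammaCrit < K.GammaMin)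
    {γ T : ℝ} (hγ1 : Real.pi / 2 - K.phiMax ≤ γ) (hγ2 : γ ≤ Real.pi / 2)
    {θ : ℝ → Fin n → ℝ} (hθ : ∀ t ∈ Icc 0 T, HasDerivWithinAt θ (K.field (θ t)) (Icc 0 T) t)
    (h0 : θ 0 ∈ arcPolytope n γ) : ∀ t ∈ Icc 0 T, θ t ∈ arcPolytope n γ := by
  obtain ⟨hφm0, hφm1⟩ := K.phiMax_mem (fun i j _ => hφ0 i j) hφlt
  have hcos := K.cos_phiMax_pos (fun i j _ => hφ0 i j) hφlt
  have hb : ∀ i j, 0 ≤ K.b i j := fun i j => (K.a_nonneg_b_nonneg hD hP hφ0 hφle i j).2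
  have hcrit0 : 0 ≤ K.GammaCrit := by
    unfold GammaCrit
    exact div_nonneg (by linarith [K.freqSpread_nonneg, K.lossyMax_nonneg hb]) hcos.le
  have hmin0 : 0 ≤ K.GammaMin := hcrit0.trans hkey.le
  have hγ0 : 0 ≤ γ := le_trans (by linarith) hγ1
  have hγπ : γ ≤ Real.pi := hγ2.trans (by linarith [Real.pi_pos])
  -- `cos φ_max = sin(π/2 − φ_max) ≤ sin γ`
  have hsin : Real.cos K.phiMax ≤ Real.sin γ := by
    rw [← Real.sin_pi_div_two_sub]
    exact Real.sin_le_sin_of_le_of_le_pi_div_two (by linarith) hγ2 hγ1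
  refine K.arcPolytope_invariant hD hP hφ0 hφle hφlt hγ0 hγπ ?_ hθ h0
  calc Real.cos K.phiMax * K.GammaCrit < Real.cos K.phiMax * K.GammaMin :=
        mul_lt_mul_of_pos_left hkey hcos
    _ ≤ Real.sin γ * K.GammaMin := mul_le_mul_of_nonneg_right hsin hmin0
    _ = K.GammaMin * Real.sin γ := mul_comm _ _

/-! ### Remark 5.4: classic Kuramoto oscillators -/

/-- The classic (uniform, all-to-all) Kuramoto model `θ̇ᵢ = ωᵢ − (K/n) Σⱼ sin(θᵢ − θⱼ)` as a non-uniform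
Kuramoto model: `Dᵢ = 1`, `Pᵢⱼ = K/n` (`i ≠ j`), `Pᵢᵢ = 0`, `φ = 0`.
[cite: DorflerBullo2012, arXiv:0910.5673 §2.1 eq. (Kuramoto system); Remark 5.4] -/
def classic (n : ℕ) (Kc : ℝ) (ω : Fin n → ℝ) : NonuniformKuramoto n where
  D := fun _ => 1
  ω := ω
  P := fun i j => if i = j then 0 else Kc / n
  φ := fun _ _ => 0

/-- The field of `classic` is the classic Kuramoto right-hand side `ωᵢ − (K/n) Σⱼ sin(θᵢ − θⱼ)`
(the `j = i` summand is `sin 0 = 0`). [cite: DorflerBullo2012, arXiv:0910.5673 §2.1 eq. (Kuramoto system)] -/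
theorem classic_field (Kc : ℝ) (ω : Fin n → ℝ) (θ : Fin n → ℝ) (i : Fin n) :
    (classic n Kc ω).field θ i = ω i - Kc / n * ∑ j, Real.sin (θ i - θ j) := by
  unfold field classic
  simp only [add_zero, div_one]
  rw [Finset.mul_sum]
  congr 1
  refine Finset.sum_congr rfl fun j _ => ?_
  split_ifs with h
  · subst h; simp
  · rfl

/-- **Remark 5.4, eq. (Kuramoto bound on coupling gain K - 2)**: for the classic Kuramoto model with
natural frequencies in `[ω_min, ω_max]` and coupling `K > 0`, the set `Δ̄(π/2 − γ)`, `γ ∈ ]0, π/2]`, is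
positively invariant if `K ≥ K(γ) := (ω_max − ω_min)/cos γ` — stated multiplied out,
`ω_max − ω_min ≤ K cos γ` (no division: at `γ = π/2` it correctly demands identical frequencies). Proof:
at the levels `v ∈ ]π/2 − γ, π/2[` just above, `K sin v > K cos γ ≥ ω_max − ω_min` (strict), and
`arcPolytope_invariant_of_bounds_above`. («Our bound improves the bound `K > K(γ)n/2` … and
`K > K(γ)n/(n−2)` …».) [cite: DorflerBullo2012, arXiv:0910.5673 §5.2 Remark 5.4, eqs. (Kuramoto bound on
coupling gain K) and (Kuramoto bound on coupling gain K - 2)] -/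
theorem classic_arcPolytope_invariant {Kc ωmin ωmax γ T : ℝ} {ω : Fin n → ℝ} (hKc : 0 < Kc)
    (hω : ∀ i, ωmin ≤ ω i ∧ ω i ≤ ωmax) (hγ0 : 0 < γ) (hγ : γ ≤ Real.pi / 2)
    (hK : ωmax - ωmin ≤ Kc * Real.cos γ)
    {θ : ℝ → Fin n → ℝ}
    (hθ : ∀ t ∈ Icc 0 T, HasDerivWithinAt θ ((classic n Kc ω).field (θ t)) (Icc 0 T) t)
    (h0 : θ 0 ∈ arcPolytope n (Real.pi / 2 - γ)) :
    ∀ t ∈ Icc 0 T, θ t ∈ arcPolytope n (Real.pi / 2 - γ) := by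
  rcases Nat.eq_zero_or_pos n with hn | hn
  · subst hn
    intro t _ i
    exact i.elim0
  have hn' : (n : ℝ) ≠ 0 := by exact_mod_cast hn.ne'
  refine (classic n Kc ω).arcPolytope_invariant_of_bounds_above (γ := Real.pi / 2 - γ) (δ := γ)
    (amin := Kc / n) (Ω := ωmax - ωmin) (B := 0) (by linarith) hγ0 (by linarith [Real.pi_pos])
    (fun i j hij => ?_) (fun i j => ?_) (fun i j => ?_) (fun i => ?_) (fun v hv1 hv2 => ?_) hθ h0
  · -- `a_min = K/n`
    simp [a, classic, hij]
  · simp [b, classic]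
  · simp only [classic, div_one]
    linarith [(hω i).2, (hω j).1]
  · simp [b, classic]
  · -- strict key inequality at the level `v ∈ ]π/2 − γ, π/2[`
    have hv : Real.cos γ < Real.sin v := by
      rw [← Real.sin_pi_div_two_sub]
      exact Real.sin_lt_sin_of_lt_of_le_pi_div_two (by linarith) (by linarith) hv1
    have h1 : (n : ℝ) * (Kc / n) * Real.sin v = Kc * Real.sin v := by field_simp
    rw [h1]
    have h2 : Kc * Real.cos γ < Kc * Real.sin v := mul_lt_mul_of_pos_left hv hKc
    linarith

/-! ### Bridge: droop-controlled inverter networks (Simpson-Porco–Dörfler–Bullo Lemma 1) -/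

end NonuniformKuramoto

namespace DroopNetwork

variable {n : ℕ} (N : DroopNetwork n)

/-- **SPDB2013 Lemma 1** as a map of data: the droop-controlled inverter network with time constants
`Dᵢ`, nominal injections `Pᵢ*` and weights `aᵢⱼ = EᵢEⱼ|Yᵢⱼ|` IS the non-uniform Kuramoto model with
`ω = P*`, `P = (aᵢⱼ)`, zero phase shifts (lossless lines). [cite: SimpsonporcoDorflerBullo2013, §3 Lemma 1
(«the parametric quantities of the two models are related via `Pᵢ* = Ωᵢ` and `EᵢEⱼ|Yᵢⱼ| = aᵢⱼ`»)] -/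
def toKuramoto : NonuniformKuramoto n where
  D := N.Dc
  ω := N.Pstar
  P := N.a
  φ := fun _ _ => 0

/-- The Kuramoto field of a droop network is `(Pᵢ* − P_e,i(θ))/Dᵢ` (eq. (KuraDroop) divided by `Dᵢ`).
[cite: SimpsonporcoDorflerBullo2013, §3 eq. (KuraDroop) and Lemma 1] -/
theorem toKuramoto_field (θ : Fin n → ℝ) (i : Fin n) :
    N.toKuramoto.field θ i = (N.Pstar i - N.injection θ i) / N.Dc i := by
  simp [NonuniformKuramoto.field, toKuramoto, injection]

/-- An all-inverter droop network solution (`Dᵢ > 0` at every node, `IsSolutionAt` at the times of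
`[0, T]`) is a solution of the Kuramoto field in the tree convention.
[cite: SimpsonporcoDorflerBullo2013, §3 Lemma 1 (ii) («generalized Kuramoto model … with time constants
`Dᵢ > 0`»)] -/
theorem hasDerivWithinAt_of_isSolutionAt (hD : ∀ i, 0 < N.Dc i) {θ : ℝ → Fin n → ℝ} {T t : ℝ}
    (hsol : N.IsSolutionAt θ t) : HasDerivWithinAt θ (N.toKuramoto.field (θ t)) (Icc 0 T) t := by
  refine (hasDerivWithinAt_pi.2 fun i => ?_)
  obtain ⟨w, hw, hDw⟩ := hsol i
  have hw' : w = N.toKuramoto.field (θ t) i := by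
    rw [N.toKuramoto_field]
    field_simp [(hD i).ne']
    linarith
  rw [← hw']
  exact hw.hasDerivWithinAt

/-- **Phase cohesiveness of a lossless droop-controlled all-inverter network** (Dörfler–Bullo
synchronization condition I with `φ = 0`, read through SPDB2013 Lemma 1): if
`max_{i,j}(Pᵢ*/Dᵢ − Pⱼ*/Dⱼ) ≤ Ω < n·a_min·sin γ` with `a_min ≤ EᵢEⱼ|Yᵢⱼ|/Dᵢ` for all `i ≠ j` (so the
coupling graph must be complete for `a_min > 0`) and `γ ∈ [0, π]`, then every solution on `[0, T]` starting
in `Δ̄(γ)` stays in `Δ̄(γ)`. CERTIFIED-usable shape (two exact bounds, one inequality, independent of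
`n`); MODELLED: lossless lines, constant amplitudes, no load buses.
[cite: DorflerBullo2012, arXiv:0910.5673 §5.2 Thm 5.3 statement 1); SimpsonporcoDorflerBullo2013, §3 Lemma 1] -/
theorem arcPolytope_invariant (hD : ∀ i, 0 < N.Dc i) {γ amin Ω T : ℝ}
    (hγ0 : 0 ≤ γ) (hγπ : γ ≤ Real.pi) (hamin : ∀ i j, i ≠ j → amin ≤ N.a i j / N.Dc i)
    (hΩ : ∀ i j, N.Pstar i / N.Dc i - N.Pstar j / N.Dc j ≤ Ω) (hkey : Ω < n * amin * Real.sin γ)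
    {θ : ℝ → Fin n → ℝ} (hsol : ∀ t ∈ Icc 0 T, N.IsSolutionAt θ t)
    (h0 : θ 0 ∈ arcPolytope n γ) : ∀ t ∈ Icc 0 T, θ t ∈ arcPolytope n γ := by
  refine N.toKuramoto.arcPolytope_invariant_of_bounds (amin := amin) (Ω := Ω) (B := 0) hγ0 hγπ
    (fun i j hij => ?_) (fun i j => ?_) hΩ (fun i => ?_) (by linarith)
    (fun t ht => N.hasDerivWithinAt_of_isSolutionAt hD (hsol t ht)) h0
  · simpa [NonuniformKuramoto.a, toKuramoto] using hamin i j hij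
  · simp [NonuniformKuramoto.b, toKuramoto]
  · simp [NonuniformKuramoto.b, toKuramoto]

end DroopNetwork

/-! ### Appendix (gridfusion-lit-1 g5, append 1): reaching `Δ̄(γ')`, and frequency synchronization
(Thm 5.1 (1) / Thm 5.3 (2)) in contraction form -/

namespace NonuniformKuramoto

variable {n : ℕ} (K : NonuniformKuramoto n)

/-- **«Each trajectory starting in `Δ̄(γ)` reaches `Δ̄(γ')`»** (the second clause of Thm 5.3 statement 1),
quantitative): if the key inequality holds with a uniform MARGIN `η` on all levels between `γ'` and `γ`
— `Ω + 2B + η < n·a_min·sin v` for `v ∈ [γ', γ]`, `0 ≤ γ' ≤ γ ≤ π` — then along every solution on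
`[0, T]`, `T ≤ (γ − γ')/η`, starting in `Δ̄(γ)` the arc length shrinks at rate `η`: `θ(t) ∈ Δ̄(γ − ηt)`;
in particular `θ((γ − γ')/η) ∈ Δ̄(γ')` (`mem_arcPolytope_of_reach`). (Printed: «`V(θ(t))` is strictly
decreasing … for all `γ ∈ ]γ_min, γ_max[` … ensures that … there exists `T ≥ 0` such that
`θ(t) ∈ Δ̄(π/2 − φ_max)` for all `t ≥ T`».) Proof: the finite-barrier lemma with the moving levels
`θᵢ − θⱼ + ηt ≤ γ`. [cite: DorflerBullo2012, arXiv:0910.5673 §5.2 Thm 5.3 statement 1) («each trajectory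
starting in `Δ(γ_max)` reaches `Δ̄(γ_min)`») and the end of its proof] -/
theorem arcPolytope_reach_of_bounds {γ γ' η amin Ω B T : ℝ} (hγ' : 0 ≤ γ')
    (hγπ : γ ≤ Real.pi) (hη : 0 < η)
    (hamin : ∀ i j, i ≠ j → amin ≤ K.a i j) (hb : ∀ i j, 0 ≤ K.b i j)
    (hΩ : ∀ i j, K.ω i / K.D i - K.ω j / K.D j ≤ Ω) (hB : ∀ i, ∑ j, K.b i j ≤ B)
    (hkey : ∀ v, γ' ≤ v → v ≤ γ → Ω + 2 * B + η < n * amin * Real.sin v)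
    {θ : ℝ → Fin n → ℝ} (hθ : ∀ t ∈ Icc 0 T, HasDerivWithinAt θ (K.field (θ t)) (Icc 0 T) t)
    (h0 : θ 0 ∈ arcPolytope n γ) (hT : T ≤ (γ - γ') / η) :
    ∀ t ∈ Icc 0 T, θ t ∈ arcPolytope n (γ - η * t) := by
  -- barriers `h_(i,j)(t) = θᵢ(t) − θⱼ(t) + η t ≤ γ`
  have key := Literature.Analysis.ODE.forall_le_of_hasDerivWithinAt_of_eq_imp_deriv_neg
    (ι := Fin n × Fin n) (h := fun p t => θ t p.1 - θ t p.2 + η * t)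
    (h' := fun p t => K.field (θ t) p.1 - K.field (θ t) p.2 + η * 1) (c := fun _ => γ) (T := T)
    (fun p t ht => (((hasDerivWithinAt_pi.1 (hθ t ht)) p.1).sub
      ((hasDerivWithinAt_pi.1 (hθ t ht)) p.2)).add ((hasDerivWithinAt_id t (Icc 0 T)).const_mul η))
    (fun t ht hall p hp => by
      -- at time `t` all pairs lie in `Δ̄(v)`, `v = γ − η t ∈ [γ', γ]`, and the pair `p` is active
      have hv1 : γ' ≤ γ - η * t := by
        have : η * t ≤ η * ((γ - γ') / η) := mul_le_mul_of_nonneg_left (ht.2.trans hT) hη.le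
        rw [mul_div_cancel₀ _ hη.ne'] at this
        linarith
      have hv2 : γ - η * t ≤ γ := by nlinarith [ht.1]
      have hmem : θ t ∈ arcPolytope n (γ - η * t) := fun i j => by
        have hij : θ t i - θ t j + η * t ≤ γ := hall (i, j)
        linarith
      have hface : θ t p.1 - θ t p.2 = γ - η * t := by
        have hp' : θ t p.1 - θ t p.2 + η * t = γ := hp
        linarith
      -- `a_min ≥ 0` is forced by the key inequality (as in `field_sub_field_neg_of_face`)
      have hamin0 : 0 ≤ amin := by
        by_contra hneg
        push Not at hneg
        have hΩ0 : 0 ≤ Ω := by have := hΩ p.1 p.1; simpa using this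
        have hB0 : 0 ≤ B := (Finset.sum_nonneg fun j _ => hb p.1 j).trans (hB p.1)
        have hsin0 : 0 ≤ Real.sin (γ - η * t) :=
          Real.sin_nonneg_of_nonneg_of_le_pi (by linarith) (by linarith)
        have : (n : ℝ) * amin * Real.sin (γ - η * t) ≤ 0 :=
          mul_nonpos_of_nonpos_of_nonneg
            (mul_nonpos_of_nonneg_of_nonpos (Nat.cast_nonneg n) hneg.le) hsin0
        linarith [hkey (γ - η * t) hv1 hv2]
      have hle := K.field_sub_field_le_of_face (γ := γ - η * t) (by linarith) hamin0 hamin hb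
        hmem hface
      have h1 := hΩ p.1 p.2
      have h2 := hB p.1
      have h3 := hB p.2
      have h4 := hkey (γ - η * t) hv1 hv2
      show K.field (θ t) p.1 - K.field (θ t) p.2 + η * 1 < 0
      linarith)
    (fun p => by
      show θ 0 p.1 - θ 0 p.2 + η * 0 ≤ γ
      have := h0 p.1 p.2
      linarith)
  intro t ht i j
  have hij : θ t i - θ t j + η * t ≤ γ := key t ht (i, j)
  show θ t i - θ t j ≤ γ - η * t
  linarith

/-- Reaching, endpoint form: under the hypotheses of `arcPolytope_reach_of_bounds`, at time
`T* = (γ − γ')/η` the solution is in `Δ̄(γ')` (and stays there by `arcPolytope_invariant_of_bounds`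
when the strict inequality holds at `γ'`). [cite: DorflerBullo2012, arXiv:0910.5673 §5.2 Thm 5.3
statement 1)] -/
theorem mem_arcPolytope_of_reach {γ γ' η amin Ω B : ℝ} (hγ' : 0 ≤ γ') (hγ'γ : γ' ≤ γ)
    (hγπ : γ ≤ Real.pi) (hη : 0 < η)
    (hamin : ∀ i j, i ≠ j → amin ≤ K.a i j) (hb : ∀ i j, 0 ≤ K.b i j)
    (hΩ : ∀ i j, K.ω i / K.D i - K.ω j / K.D j ≤ Ω) (hB : ∀ i, ∑ j, K.b i j ≤ B)
    (hkey : ∀ v, γ' ≤ v → v ≤ γ → Ω + 2 * B + η < n * amin * Real.sin v)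
    {θ : ℝ → Fin n → ℝ}
    (hθ : ∀ t ∈ Icc 0 ((γ - γ') / η), HasDerivWithinAt θ (K.field (θ t)) (Icc 0 ((γ - γ') / η)) t)
    (h0 : θ 0 ∈ arcPolytope n γ) : θ ((γ - γ') / η) ∈ arcPolytope n γ' := by
  have hT0 : 0 ≤ (γ - γ') / η := div_nonneg (by linarith) hη.le
  have h := K.arcPolytope_reach_of_bounds hγ' hγπ hη hamin hb hΩ hB hkey hθ h0 le_rfl
    ((γ - γ') / η) ⟨hT0, le_rfl⟩
  have heq : γ - η * ((γ - γ') / η) = γ' := by field_simp; ring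
  rwa [heq] at h

/-- **The frequency dynamics** (eq. (dot theta dynamics)): along a solution, each velocity
`yᵢ(t) = θ̇ᵢ(t)` is differentiable with
`ẏᵢ = −Σⱼ (Pᵢⱼ cos(θᵢ − θⱼ + φᵢⱼ)/Dᵢ)(yᵢ − yⱼ)` — a linear consensus protocol for the velocities with
state-dependent weights `aᵢⱼ(t) = (Pᵢⱼ/Dᵢ) cos(θᵢ(t) − θⱼ(t) + φᵢⱼ)`
(«`d/dt Dᵢθ̇ᵢ = −Σⱼ Pᵢⱼ cos(θᵢ−θⱼ+φᵢⱼ)(θ̇ᵢ − θ̇ⱼ)`»).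
[cite: DorflerBullo2012, arXiv:0910.5673 §5.1 proof of Thm 5.1, eqs. (dot theta dynamics) and (LPV
concensus system for dot theta)] -/
theorem hasDerivWithinAt_field {θ : ℝ → Fin n → ℝ} {T t : ℝ}
    (hθ : HasDerivWithinAt θ (K.field (θ t)) (Icc 0 T) t) (i : Fin n) :
    HasDerivWithinAt (fun s => K.field (θ s) i)
      (-∑ j, K.P i j * Real.cos (θ t i - θ t j + K.φ i j) / K.D i
        * (K.field (θ t) i - K.field (θ t) j)) (Icc 0 T) t := by
  have hc := hasDerivWithinAt_pi.1 hθ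
  have hsum : HasDerivWithinAt (fun s => ∑ j, K.P i j * Real.sin (θ s i - θ s j + K.φ i j))
      (∑ j, K.P i j * (Real.cos (θ t i - θ t j + K.φ i j) * (K.field (θ t) i - K.field (θ t) j)))
      (Icc 0 T) t := by
    refine HasDerivWithinAt.fun_sum fun j _ => ?_
    have h1 : HasDerivWithinAt (fun s => θ s i - θ s j + K.φ i j)
        (K.field (θ t) i - K.field (θ t) j) (Icc 0 T) t := by
      simpa using ((hc i).sub (hc j)).add_const (K.φ i j)
    exact ((Real.hasDerivAt_sin _).comp_hasDerivWithinAt t h1).const_mul (K.P i j)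
  have h := (hsum.const_sub (K.ω i)).div_const (K.D i)
  refine h.congr_deriv ?_
  rw [neg_div, Finset.sum_div]
  congr 1
  exact Finset.sum_congr rfl fun j _ => by ring

/-- On `Δ̄(γ)` with `0 ≤ φᵢⱼ ≤ φ̄` and `γ + φ̄ ≤ π/2` the consensus weights are bounded below:
`Pᵢⱼ cos(γ + φ̄)/Dᵢ ≤ Pᵢⱼ cos(θᵢ − θⱼ + φᵢⱼ)/Dᵢ`, and they are `≥ 0` («the weights `aᵢⱼ(t)` are
non-degenerate … strictly positive … for all `t ≥ 0`»). [cite: DorflerBullo2012, arXiv:0910.5673 §5.1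
proof of Thm 5.1 (text after eq. (dot theta dynamics))] -/
theorem weight_lower_of_mem_arcPolytope (hD : ∀ i, 0 < K.D i) (hP : ∀ i j, 0 ≤ K.P i j)
    {γ φbar : ℝ} (hφ0 : ∀ i j, 0 ≤ K.φ i j) (hφ : ∀ i j, K.φ i j ≤ φbar)
    (hγφ : γ + φbar ≤ Real.pi / 2) {θ : Fin n → ℝ} (hθ : θ ∈ arcPolytope n γ) (i j : Fin n) :
    K.P i j * Real.cos (γ + φbar) / K.D i ≤ K.P i j * Real.cos (θ i - θ j + K.φ i j) / K.D i ∧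
      0 ≤ K.P i j * Real.cos (θ i - θ j + K.φ i j) / K.D i := by
  have h1 : |θ i - θ j + K.φ i j| ≤ γ + φbar := by
    rw [abs_le]
    have := hθ i j
    have := hθ j i
    constructor <;> linarith [hφ0 i j, hφ i j]
  have hcos : Real.cos (γ + φbar) ≤ Real.cos (θ i - θ j + K.φ i j) := by
    rw [← Real.cos_abs (θ i - θ j + K.φ i j)]
    exact Real.cos_le_cos_of_nonneg_of_le_pi (abs_nonneg _) (by linarith [Real.pi_pos]) h1
  have hcos0 : 0 ≤ Real.cos (θ i - θ j + K.φ i j) := by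
    rw [← Real.cos_abs (θ i - θ j + K.φ i j)]
    exact Real.cos_nonneg_of_neg_pi_div_two_le_of_le
      (by linarith [abs_nonneg (θ i - θ j + K.φ i j), Real.pi_pos]) (h1.trans hγφ)
  exact ⟨div_le_div_of_nonneg_right (mul_le_mul_of_nonneg_left hcos (hP i j)) (hD i).le,
    div_nonneg (mul_nonneg (hP i j) hcos0) (hD i).le⟩

/-- **Frequency contraction on a positively invariant `Δ̄(γ)`** (Thm 5.1 statement (1) / Thm 5.3
statement (2), a priori form on `[0, T]`, complete coupling). Parameters as printed, `0 ≤ φᵢⱼ ≤ φ̄`,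
`γ + φ̄ ≤ π/2`, a weight floor `w ≤ Pᵢⱼ cos(γ + φ̄)/Dᵢ` for `i ≠ j`, and a solution that stays in `Δ̄(γ)`
on `[0, T]`. Then the velocities `yᵢ = θ̇ᵢ` satisfy: (i) `yᵢ(t) ≤ y_max` if all `yⱼ(0) ≤ y_max`;
(ii) `y_min ≤ yᵢ(t)` if all `y_min ≤ yⱼ(0)`; (iii) `yᵢ(t) − yⱼ(t) ≤ V₀ e^{−n w t}` if all
`yᵢ(0) − yⱼ(0) ≤ V₀` — «`θ̇ᵢ(t) ∈ [θ̇_min(0), θ̇_max(0)]` for all `t ≥ 0`» and exponential synchronization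
of the frequencies. Proof = the max/min contraction of the consensus dynamics `ẏ = −L(aᵢⱼ(t)) y`
(`ẏ_max ≤ 0 ≤ ẏ_min`, `d/dt(y_max − y_min) ≤ −n w (y_max − y_min)`), made rigorous with the
finite-barrier lemma and an exponential slack `ε eᵗ`. (The printed theorem allows any graph with a
globally reachable node via Moreau's contraction property; typed here with the complete-graph floor
`w`, the setting of Thm 5.3.) [cite: DorflerBullo2012, arXiv:0910.5673 §5.1 Thm 5.1 statement (1) and
its proof («It follows from the contraction property …»); §5.2 Thm 5.3 statement 2)] -/
theorem frequency_contraction (hD : ∀ i, 0 < K.D i) (hP : ∀ i j, 0 ≤ K.P i j)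
    {γ φbar w T : ℝ} (hφ0 : ∀ i j, 0 ≤ K.φ i j) (hφ : ∀ i j, K.φ i j ≤ φbar)
    (hγφ : γ + φbar ≤ Real.pi / 2) (hw : ∀ i j, i ≠ j → w ≤ K.P i j * Real.cos (γ + φbar) / K.D i)
    {θ : ℝ → Fin n → ℝ} (hθ : ∀ t ∈ Icc 0 T, HasDerivWithinAt θ (K.field (θ t)) (Icc 0 T) t)
    (hinv : ∀ t ∈ Icc 0 T, θ t ∈ arcPolytope n γ) {ymax ymin V0 : ℝ}
    (hmax : ∀ i, K.field (θ 0) i ≤ ymax) (hmin : ∀ i, ymin ≤ K.field (θ 0) i)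
    (hV0 : ∀ i j, K.field (θ 0) i - K.field (θ 0) j ≤ V0) :
    ∀ t ∈ Icc 0 T, (∀ i, K.field (θ t) i ≤ ymax) ∧ (∀ i, ymin ≤ K.field (θ t) i) ∧
      ∀ i j, K.field (θ t) i - K.field (θ t) j ≤ V0 * Real.exp (-(n * w) * t) := by
  -- notation: velocities `y` and weights `a` along the solution
  obtain ⟨y, hy⟩ : ∃ y : ℝ → Fin n → ℝ, ∀ s i, y s i = K.field (θ s) i := ⟨_, fun _ _ => rfl⟩
  obtain ⟨a, ha⟩ : ∃ a : ℝ → Fin n → Fin n → ℝ,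
      ∀ s i j, a s i j = K.P i j * Real.cos (θ s i - θ s j + K.φ i j) / K.D i := ⟨_, fun _ _ _ => rfl⟩
  have hwt : ∀ t ∈ Icc 0 T, ∀ i j, (i ≠ j → w ≤ a t i j) ∧ 0 ≤ a t i j := by
    intro t ht i j
    obtain ⟨h1, h2⟩ := K.weight_lower_of_mem_arcPolytope hD hP hφ0 hφ hγφ (hinv t ht) i j
    rw [ha]
    exact ⟨fun hij => (hw i j hij).trans h1, h2⟩
  have hyd : ∀ t ∈ Icc 0 T, ∀ i, HasDerivWithinAt (fun s => y s i)
      (-∑ j, a t i j * (y t i - y t j)) (Icc 0 T) t := by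
    intro t ht i
    have e1 : (fun s => y s i) = fun s => K.field (θ s) i := funext fun s => hy s i
    rw [e1]
    simp only [hy, ha]
    exact K.hasDerivWithinAt_field (hθ t ht) i
  have hmax' : ∀ i, y 0 i ≤ ymax := fun i => by rw [hy]; exact hmax i
  have hmin' : ∀ i, ymin ≤ y 0 i := fun i => by rw [hy]; exact hmin i
  have hV0' : ∀ i j, y 0 i - y 0 j ≤ V0 := fun i j => by rw [hy, hy]; exact hV0 i j
  -- (a) `ẏᵢ ≤ 0` when `yᵢ` is maximal, `ẏᵢ ≥ 0` when minimal
  have hdmax : ∀ t ∈ Icc 0 T, ∀ i, (∀ j, y t j ≤ y t i) → -∑ j, a t i j * (y t i - y t j) ≤ 0 := by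
    intro t ht i hi
    rw [neg_nonpos]
    exact Finset.sum_nonneg fun j _ => mul_nonneg (hwt t ht i j).2 (by linarith [hi j])
  have hdmin : ∀ t ∈ Icc 0 T, ∀ i, (∀ j, y t i ≤ y t j) → 0 ≤ -∑ j, a t i j * (y t i - y t j) := by
    intro t ht i hi
    rw [← Finset.sum_neg_distrib]
    exact Finset.sum_nonneg fun j _ => by
      have := mul_nonneg (hwt t ht i j).2 (show 0 ≤ y t j - y t i by linarith [hi j])
      linarith
  -- (b) the pair contraction `ẏₘ − ẏ_ℓ ≤ −n w (yₘ − y_ℓ)` when `m` is maximal and `ℓ` minimal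
  have hdpair : ∀ t ∈ Icc 0 T, ∀ m l, (∀ j, y t j ≤ y t m) → (∀ j, y t l ≤ y t j) →
      -∑ j, a t m j * (y t m - y t j) - -∑ j, a t l j * (y t l - y t j)
        ≤ -(n * w) * (y t m - y t l) := by
    intro t ht m l hm hl
    have h1 : ∀ j, w * (y t m - y t j) ≤ a t m j * (y t m - y t j) := by
      intro j
      rcases eq_or_ne m j with hmj | hmj
      · subst hmj; simp
      · exact mul_le_mul_of_nonneg_right ((hwt t ht m j).1 hmj) (by linarith [hm j])
    have h2 : ∀ j, w * (y t j - y t l) ≤ -(a t l j * (y t l - y t j)) := by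
      intro j
      rcases eq_or_ne l j with hlj | hlj
      · subst hlj; simp
      · have := mul_le_mul_of_nonneg_right ((hwt t ht l j).1 hlj)
          (show 0 ≤ y t j - y t l by linarith [hl j])
        linarith
    have hs1 := Finset.sum_le_sum fun j (_ : j ∈ (Finset.univ : Finset (Fin n))) => h1 j
    have hs2 := Finset.sum_le_sum fun j (_ : j ∈ (Finset.univ : Finset (Fin n))) => h2 j
    have hsum : ∑ j, (w * (y t m - y t j)) + ∑ j, (w * (y t j - y t l))
        = n * w * (y t m - y t l) := by
      rw [← Finset.sum_add_distrib, Finset.sum_congr rfl fun j _ => show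
        w * (y t m - y t j) + w * (y t j - y t l) = w * (y t m - y t l) by ring, Finset.sum_const,
        Finset.card_univ, Fintype.card_fin, nsmul_eq_mul]
      ring
    rw [Finset.sum_neg_distrib] at hs2
    linarith
  -- the three barrier families, each with slack `ε eˢ`, then `ε → 0`
  have hexp : ∀ t, HasDerivWithinAt (fun s => Real.exp s) (Real.exp t) (Icc 0 T) t :=
    fun t => (Real.hasDerivAt_exp t).hasDerivWithinAt
  intro t ht
  have hyt : ∀ i, K.field (θ t) i = y t i := fun i => (hy t i).symm
  simp only [hyt]
  refine ⟨fun i => ?_, fun i => ?_, fun i j => ?_⟩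
  · -- (i) upper bound
    refine le_of_forall_pos_le_add fun ε hε => ?_
    have hε' : 0 < ε / Real.exp t := div_pos hε (Real.exp_pos t)
    have key := Literature.Analysis.ODE.forall_le_of_hasDerivWithinAt_of_eq_imp_deriv_neg
      (ι := Fin n) (h := fun i s => y s i - ε / Real.exp t * Real.exp s)
      (h' := fun i s => -∑ j, a s i j * (y s i - y s j) - ε / Real.exp t * Real.exp s)
      (c := fun _ => ymax) (T := T)
      (fun i s hs => (hyd s hs i).sub ((hexp s).const_mul _))
      (fun s hs hall i hi => by
        have hi' : y s i - ε / Real.exp t * Real.exp s = ymax := hi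
        have hmaxi : ∀ j, y s j ≤ y s i := fun j => by
          have hj : y s j - ε / Real.exp t * Real.exp s ≤ ymax := hall j
          linarith
        have := hdmax s hs i hmaxi
        have hpos : 0 < ε / Real.exp t * Real.exp s := mul_pos hε' (Real.exp_pos s)
        show -∑ j, a s i j * (y s i - y s j) - ε / Real.exp t * Real.exp s < 0
        linarith)
      (fun i => by
        have := hmax' i
        have hpos : 0 < ε / Real.exp t * Real.exp 0 := mul_pos hε' (Real.exp_pos 0)
        show y 0 i - ε / Real.exp t * Real.exp 0 ≤ ymax
        linarith)
    have hk : y t i - ε / Real.exp t * Real.exp t ≤ ymax := key t ht i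
    rw [div_mul_cancel₀ _ (Real.exp_pos t).ne'] at hk
    linarith
  · -- (ii) lower bound (barriers `−yᵢ − ε eˢ ≤ −y_min`)
    rw [← sub_nonneg]
    refine le_of_forall_pos_le_add fun ε hε => ?_
    have hε' : 0 < ε / Real.exp t := div_pos hε (Real.exp_pos t)
    have key := Literature.Analysis.ODE.forall_le_of_hasDerivWithinAt_of_eq_imp_deriv_neg
      (ι := Fin n) (h := fun i s => -y s i - ε / Real.exp t * Real.exp s)
      (h' := fun i s => -(-∑ j, a s i j * (y s i - y s j)) - ε / Real.exp t * Real.exp s)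
      (c := fun _ => -ymin) (T := T)
      (fun i s hs => (hyd s hs i).neg.sub ((hexp s).const_mul _))
      (fun s hs hall i hi => by
        have hi' : -y s i - ε / Real.exp t * Real.exp s = -ymin := hi
        have hmini : ∀ j, y s i ≤ y s j := fun j => by
          have hj : -y s j - ε / Real.exp t * Real.exp s ≤ -ymin := hall j
          linarith
        have := hdmin s hs i hmini
        have hpos : 0 < ε / Real.exp t * Real.exp s := mul_pos hε' (Real.exp_pos s)
        show -(-∑ j, a s i j * (y s i - y s j)) - ε / Real.exp t * Real.exp s < 0
        linarith)
      (fun i => by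
        have := hmin' i
        have hpos : 0 < ε / Real.exp t * Real.exp 0 := mul_pos hε' (Real.exp_pos 0)
        show -y 0 i - ε / Real.exp t * Real.exp 0 ≤ -ymin
        linarith)
    have hk : -y t i - ε / Real.exp t * Real.exp t ≤ -ymin := key t ht i
    rw [div_mul_cancel₀ _ (Real.exp_pos t).ne'] at hk
    linarith
  · -- (iii) exponential contraction (barriers `e^{nwt}(yᵢ − yⱼ) − ε eˢ ≤ V₀` over pairs)
    have hE : ∀ s, HasDerivWithinAt (fun s => Real.exp (n * w * s)) (Real.exp (n * w * s) * (n * w))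
        (Icc 0 T) s := fun s => by
      have := ((hasDerivAt_id s).const_mul (n * w : ℝ)).exp
      simpa using this.hasDerivWithinAt
    suffices hmain : Real.exp (n * w * t) * (y t i - y t j) ≤ V0 by
      have hpos := Real.exp_pos (n * w * t)
      have h1 : y t i - y t j ≤ V0 / Real.exp (n * w * t) := by
        rw [le_div_iff₀ hpos]; linarith
      calc y t i - y t j ≤ V0 / Real.exp (n * w * t) := h1
        _ = V0 * Real.exp (-(n * w) * t) := by
          rw [div_eq_mul_inv, ← Real.exp_neg]; ring_nf
    refine le_of_forall_pos_le_add fun ε hε => ?_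
    have hε' : 0 < ε / Real.exp t := div_pos hε (Real.exp_pos t)
    have key := Literature.Analysis.ODE.forall_le_of_hasDerivWithinAt_of_eq_imp_deriv_neg
      (ι := Fin n × Fin n)
      (h := fun p s => Real.exp (n * w * s) * (y s p.1 - y s p.2) - ε / Real.exp t * Real.exp s)
      (h' := fun p s => (Real.exp (n * w * s) * (n * w) * (y s p.1 - y s p.2)
          + Real.exp (n * w * s) *
            (-∑ k, a s p.1 k * (y s p.1 - y s k) - -∑ k, a s p.2 k * (y s p.2 - y s k)))
          - ε / Real.exp t * Real.exp s)
      (c := fun _ => V0) (T := T)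
      (fun p s hs => ((hE s).mul ((hyd s hs p.1).sub (hyd s hs p.2))).sub ((hexp s).const_mul _))
      (fun s hs hall p hp => by
        have hEpos := Real.exp_pos (n * w * s)
        have hpos : 0 < ε / Real.exp t * Real.exp s := mul_pos hε' (Real.exp_pos s)
        have hp' : Real.exp (n * w * s) * (y s p.1 - y s p.2) - ε / Real.exp t * Real.exp s = V0 :=
          hp
        -- `p` realises the maximal velocity difference at time `s`: `p.1` is a max, `p.2` a min
        have hdiff : ∀ u v, y s u - y s v ≤ y s p.1 - y s p.2 := fun u v => by
          have huv : Real.exp (n * w * s) * (y s u - y s v) - ε / Real.exp t * Real.exp s ≤ V0 :=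
            hall (u, v)
          exact le_of_mul_le_mul_left (by linarith) hEpos
        have hm : ∀ k, y s k ≤ y s p.1 := fun k => by have := hdiff k p.2; linarith
        have hl : ∀ k, y s p.2 ≤ y s k := fun k => by have := hdiff p.1 k; linarith
        have hc := hdpair s hs p.1 p.2 hm hl
        have hprod : Real.exp (n * w * s) * (n * w) * (y s p.1 - y s p.2) + Real.exp (n * w * s) *
            (-∑ k, a s p.1 k * (y s p.1 - y s k) - -∑ k, a s p.2 k * (y s p.2 - y s k)) ≤ 0 := by
          have := mul_le_mul_of_nonneg_left hc hEpos.le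
          nlinarith
        show Real.exp (n * w * s) * (n * w) * (y s p.1 - y s p.2) + Real.exp (n * w * s) *
            (-∑ k, a s p.1 k * (y s p.1 - y s k) - -∑ k, a s p.2 k * (y s p.2 - y s k))
            - ε / Real.exp t * Real.exp s < 0
        linarith)
      (fun p => by
        have := hV0' p.1 p.2
        have hpos : 0 < ε / Real.exp t * Real.exp 0 := mul_pos hε' (Real.exp_pos 0)
        show Real.exp (n * w * 0) * (y 0 p.1 - y 0 p.2) - ε / Real.exp t * Real.exp 0 ≤ V0
        rw [mul_zero, Real.exp_zero, one_mul]
        linarith)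
    have hk : Real.exp (n * w * t) * (y t i - y t j) - ε / Real.exp t * Real.exp t ≤ V0 :=
      key t ht (i, j)
    rw [div_mul_cancel₀ _ (Real.exp_pos t).ne'] at hk
    linarith

/-! ### Appendix (gridfusion-lit-1 g5, append 2): Thm 5.3 (1)+(2) packaged; the limit frequency -/

/-- **Theorem 5.3, statements 1) and 2) together (bounds form).** Parameters as printed
(`Dᵢ > 0`, `Pᵢⱼ ≥ 0`, `0 ≤ φᵢⱼ ≤ φ̄`), a level `γ ≥ 0` with `γ + φ̄ ≤ π/2`, exact bounds `Ω`, `B`, `a_min`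
with the strict key inequality `Ω + 2B < n·a_min·sin γ`, and a weight floor `w ≤ Pᵢⱼ cos(γ + φ̄)/Dᵢ`
(`i ≠ j`): every solution on `[0, T]` from `Δ̄(γ)` stays PHASE COHESIVE in `Δ̄(γ)` and its frequencies
stay in `[min θ̇(0), max θ̇(0)]` and CONTRACT, `θ̇ᵢ(t) − θ̇ⱼ(t) ≤ V₀ e^{−n w t}`.
[cite: DorflerBullo2012, arXiv:0910.5673 §5.2 Thm 5.3 statements 1)–2); §3.2 Thm 3.2 statements 1)–2)] -/
theorem cohesive_and_contracting_of_bounds (hD : ∀ i, 0 < K.D i) (hP : ∀ i j, 0 ≤ K.P i j)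
    {γ φbar amin Ω B w T : ℝ} (hφ0 : ∀ i j, 0 ≤ K.φ i j) (hφ : ∀ i j, K.φ i j ≤ φbar)
    (hγ0 : 0 ≤ γ) (hγφ : γ + φbar ≤ Real.pi / 2)
    (hamin : ∀ i j, i ≠ j → amin ≤ K.a i j)
    (hΩ : ∀ i j, K.ω i / K.D i - K.ω j / K.D j ≤ Ω) (hB : ∀ i, ∑ j, K.b i j ≤ B)
    (hkey : Ω + 2 * B < n * amin * Real.sin γ)
    (hw : ∀ i j, i ≠ j → w ≤ K.P i j * Real.cos (γ + φbar) / K.D i)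
    {θ : ℝ → Fin n → ℝ} (hθ : ∀ t ∈ Icc 0 T, HasDerivWithinAt θ (K.field (θ t)) (Icc 0 T) t)
    (h0 : θ 0 ∈ arcPolytope n γ) {ymax ymin V0 : ℝ}
    (hmax : ∀ i, K.field (θ 0) i ≤ ymax) (hmin : ∀ i, ymin ≤ K.field (θ 0) i)
    (hV0 : ∀ i j, K.field (θ 0) i - K.field (θ 0) j ≤ V0) :
    ∀ t ∈ Icc 0 T, θ t ∈ arcPolytope n γ ∧ (∀ i, K.field (θ t) i ≤ ymax) ∧
      (∀ i, ymin ≤ K.field (θ t) i) ∧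
      ∀ i j, K.field (θ t) i - K.field (θ t) j ≤ V0 * Real.exp (-(n * w) * t) := by
  rcases isEmpty_or_nonempty (Fin n) with hE | ⟨⟨i₀⟩⟩
  · intro t _
    exact ⟨fun i => (hE.false i).elim, fun i => (hE.false i).elim, fun i => (hE.false i).elim,
      fun i => (hE.false i).elim⟩
  have hφbar : 0 ≤ φbar := (hφ0 i₀ i₀).trans (hφ i₀ i₀)
  have hγπ : γ ≤ Real.pi := by linarith [Real.pi_pos]
  have hφle : ∀ i j, K.φ i j ≤ Real.pi / 2 := fun i j => by linarith [hφ i j]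
  have hb : ∀ i j, 0 ≤ K.b i j := fun i j => (K.a_nonneg_b_nonneg hD hP hφ0 hφle i j).2
  have hinv := K.arcPolytope_invariant_of_bounds hγ0 hγπ hamin hb hΩ hB hkey hθ h0
  intro t ht
  exact ⟨hinv t ht, K.frequency_contraction hD hP hφ0 hφ hγφ hw hθ hinv hmax hmin hV0 t ht⟩

/-- **The synchronization frequency `θ̇_∞`** (Thm 5.1 (1): «the frequencies `θ̇ᵢ(t)` synchronize
exponentially to some frequency `θ̇_∞ ∈ [θ̇_min(0), θ̇_max(0)]`»), for a GLOBAL solution staying in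
`Δ̄(γ)`, `γ + φ̄ ≤ π/2`, with the complete-graph weight floor `w`: there is `θ̇_∞` between the initial
extreme frequencies with `|θ̇ᵢ(t) − θ̇_∞| ≤ V₀ e^{−n w t}` for all `t ≥ 0` and all `i`; in particular
(`n w > 0`) every `θ̇ᵢ(t) → θ̇_∞`. Construction: `θ̇_∞ = inf_{s ≥ 0} maxᵢ θ̇ᵢ(s)` (the maximum is
non-increasing and the minimum non-decreasing along the flow, by `frequency_contraction` applied to
time-shifted solutions), squeezed by the contraction estimate. [cite: DorflerBullo2012,
arXiv:0910.5673 §5.1 Thm 5.1 statement (1) and proof; §5.2 Thm 5.3 statement 2)] -/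
theorem exists_syncFrequency (hD : ∀ i, 0 < K.D i) (hP : ∀ i j, 0 ≤ K.P i j)
    {γ φbar w : ℝ} (hφ0 : ∀ i j, 0 ≤ K.φ i j) (hφ : ∀ i j, K.φ i j ≤ φbar)
    (hγφ : γ + φbar ≤ Real.pi / 2) (hw : ∀ i j, i ≠ j → w ≤ K.P i j * Real.cos (γ + φbar) / K.D i)
    {θ : ℝ → Fin n → ℝ} (hθ : ∀ T : ℝ, ∀ t ∈ Icc 0 T, HasDerivWithinAt θ (K.field (θ t)) (Icc 0 T) t)
    (hinv : ∀ t, 0 ≤ t → θ t ∈ arcPolytope n γ) {ymax ymin V0 : ℝ}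
    (hmax : ∀ i, K.field (θ 0) i ≤ ymax) (hmin : ∀ i, ymin ≤ K.field (θ 0) i)
    (hV0 : ∀ i j, K.field (θ 0) i - K.field (θ 0) j ≤ V0) (hn : 0 < n) :
    ∃ θinf : ℝ, ymin ≤ θinf ∧ θinf ≤ ymax ∧
      (∀ t, 0 ≤ t → ∀ i, |K.field (θ t) i - θinf| ≤ V0 * Real.exp (-(n * w) * t)) ∧
      (0 < w → ∀ i, Tendsto (fun t => K.field (θ t) i) atTop (𝓝 θinf)) := by
  haveI : Nonempty (Fin n) := ⟨⟨0, hn⟩⟩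
  -- velocities, their max `M` and min `m` over the oscillators
  obtain ⟨y, hy⟩ : ∃ y : ℝ → Fin n → ℝ, ∀ s i, y s i = K.field (θ s) i := ⟨_, fun _ _ => rfl⟩
  set M : ℝ → ℝ := fun s => ⨆ i, y s i with hM
  set m : ℝ → ℝ := fun s => ⨅ i, y s i with hm
  have hleM : ∀ s i, y s i ≤ M s := fun s i =>
    le_ciSup (f := fun i => y s i) (Set.finite_range _).bddAbove i
  have hmle : ∀ s i, m s ≤ y s i := fun s i =>
    ciInf_le (f := fun i => y s i) (Set.finite_range _).bddBelow i
  have hMatt : ∀ s, ∃ i, y s i = M s := fun s => exists_eq_ciSup_of_finite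
  have hmatt : ∀ s, ∃ i, y s i = m s := fun s => exists_eq_ciInf_of_finite
  -- `frequency_contraction` on the solution shifted by `s ≥ 0`, observed at `s + u`
  have hshift : ∀ s, 0 ≤ s → ∀ u, 0 ≤ u → ∀ i, y (s + u) i ≤ M s ∧ m s ≤ y (s + u) i := by
    intro s hs u hu i
    have hθs := Literature.Analysis.ODE.hasDerivWithinAt_comp_add_of_solution hθ hs
    have h := K.frequency_contraction hD hP hφ0 hφ hγφ hw (T := u) (θ := fun r => θ (s + r))
      (hθs u) (fun r hr => hinv (s + r) (by linarith [hr.1])) (ymax := M s) (ymin := m s)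
      (V0 := M s - m s)
      (fun j => by simpa [← hy] using hleM s j) (fun j => by simpa [← hy] using hmle s j)
      (fun j k => by
        have h1 := hleM s j; have h2 := hmle s k
        simp only [add_zero, ← hy]; linarith)
      u ⟨hu, le_rfl⟩
    exact ⟨by simpa [← hy] using h.1 i, by simpa [← hy] using h.2.1 i⟩
  have hManti : ∀ s t, 0 ≤ s → s ≤ t → M t ≤ M s := fun s t hs hst => by
    obtain ⟨i, hi⟩ := hMatt t
    have := (hshift s hs (t - s) (by linarith) i).1
    rw [show s + (t - s) = t by ring, hi] at this
    exact this
  have hmmono : ∀ s t, 0 ≤ s → s ≤ t → m s ≤ m t := fun s t hs hst => by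
    obtain ⟨i, hi⟩ := hmatt t
    have := (hshift s hs (t - s) (by linarith) i).2
    rw [show s + (t - s) = t by ring, hi] at this
    exact this
  have hmM : ∀ s, m s ≤ M s := fun s => by
    obtain ⟨i, hi⟩ := hMatt s
    exact (hmle s i).trans_eq hi
  -- the contraction estimate from time `0`: `M t − m t ≤ V₀ e^{−nwt}`
  have hgap : ∀ t, 0 ≤ t → M t - m t ≤ V0 * Real.exp (-(n * w) * t) := by
    intro t ht
    obtain ⟨i, hi⟩ := hMatt t
    obtain ⟨j, hj⟩ := hmatt t
    have h := (K.frequency_contraction hD hP hφ0 hφ hγφ hw (hθ t) (fun r hr => hinv r hr.1)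
      hmax hmin hV0 t ⟨ht, le_rfl⟩).2.2 i j
    rw [← hy, ← hy, hi, hj] at h
    exact h
  -- the limit frequency: `θ̇_∞ := inf_{s ≥ 0} M s`
  set θinf : ℝ := ⨅ s : {s : ℝ // 0 ≤ s}, M s.1 with hθinf
  have hbdd : BddBelow (Set.range fun s : {s : ℝ // 0 ≤ s} => M s.1) := by
    refine ⟨m 0, ?_⟩
    rintro _ ⟨s, rfl⟩
    exact (hmmono 0 s.1 le_rfl s.2).trans (hmM s.1)
  have hinfle : ∀ t, 0 ≤ t → θinf ≤ M t := fun t ht =>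
    ciInf_le hbdd (⟨t, ht⟩ : {s : ℝ // 0 ≤ s})
  have hleinf : ∀ t, 0 ≤ t → m t ≤ θinf := by
    intro t ht
    haveI : Nonempty {s : ℝ // 0 ≤ s} := ⟨⟨0, le_rfl⟩⟩
    refine le_ciInf fun s => ?_
    rcases le_total t s.1 with hts | hst
    · exact (hmmono t s.1 ht hts).trans (hmM s.1)
    · exact (hmM t).trans (hManti s.1 t s.2 hst)
  have hrate : ∀ t, 0 ≤ t → ∀ i, |K.field (θ t) i - θinf| ≤ V0 * Real.exp (-(n * w) * t) := by
    intro t ht i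
    rw [← hy, abs_le]
    have h1 := hleM t i; have h2 := hmle t i
    have h3 := hinfle t ht; have h4 := hleinf t ht; have h5 := hgap t ht
    constructor <;> linarith
  refine ⟨θinf, ?_, ?_, hrate, fun hw0 i => ?_⟩
  · -- `y_min ≤ m 0 ≤ θ̇_∞`
    refine le_trans ?_ (hleinf 0 le_rfl)
    exact le_ciInf fun i => by rw [hy]; exact hmin i
  · -- `θ̇_∞ ≤ M 0 ≤ y_max`
    refine (hinfle 0 le_rfl).trans ?_
    exact ciSup_le fun i => by rw [hy]; exact hmax i
  · -- convergence: squeeze by `V₀ e^{−nwt} → 0`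
    have hnw : -(n * w : ℝ) < 0 := by
      have : (0 : ℝ) < n := by exact_mod_cast hn
      nlinarith
    have hexp : Tendsto (fun t : ℝ => V0 * Real.exp (-(n * w) * t)) atTop (𝓝 0) := by
      have h1 : Tendsto (fun t : ℝ => -(n * w) * t) atTop atBot :=
        tendsto_id.const_mul_atTop_of_neg hnw
      have h2 := Real.tendsto_exp_atBot.comp h1
      simpa using h2.const_mul V0
    rw [tendsto_iff_norm_sub_tendsto_zero]
    refine squeeze_zero' (Eventually.of_forall fun t => norm_nonneg _) ?_ hexp
    filter_upwards [eventually_ge_atTop (0 : ℝ)] with t ht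
    rw [Real.norm_eq_abs]
    exact hrate t ht i

end NonuniformKuramoto

end Literature.MathematicalPhysics.PowerSystems
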